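import Literature.Barriers.CriticalPhenomena.PlaquetteWalkIsthmusRoot
import HarnessLib

/-!
# The hole defect law at an isthmus root (YB-ISTHMUS Part 3) — Yang–Baxter plaquette walk on ℤ²

Topic `Literature/Barriers/CriticalPhenomena`; venture lane «pcv-sawmu» (CriticalPhenomena, Tier B), sequel of
`PlaquetteWalkIsthmusRoot` (Part 1: at an isthmus hole root the Yang–Baxter vertex identity holds at every
plaquette `f₀ ≠ w`; Part 2: the defect at `w` expands over the two slot observables of `D ∖ {w}`).

Setting (as in Parts 1/2): `Dl` a finite face list, `w ∈ Dl`, `σ` a side of `w` whose outward plaquette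
`nbr w σ` is NOT in `Dl` (the hole side), and the opposite side `w.side σ.opp` an OUTER root of `dom Dl`
(`w` is a width-one isthmus between the hole and the outside). `ℓ = lat σ` is a lateral side, `q = qTurn σ ℓ = ∓1`,
`X = G_{D∖w}(w.side ℓ → w.side ℓ.opp)` and `Y` (reverse) the two slot observables, `dc = defectCoeff`,
`v(θ) = weightV θ`, `c = ybCoeff θ = (1, r(θ), −1, −r(θ))`, `t = e^{−5iπ/16}`.

Results (all kernel-checked, axioms standard):
* (3) `slot_relation_printed`: `dc(σ.opp,ℓ)·X + dc(σ.opp,ℓ.opp)·Y = 0` — C-B2 at the OUTER root of the same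
  plaquette + Part 2 there; `defectDet`, `vertexFunctional_printed_isthmus_root_eq_single`.
* (3c) `defectCoeff_ybCurve_values`: on the curve `W = ybCurve(−1) t r` the eight defect coefficients are
  MONOMIALS `±v t^{±4}`, `±r v t^{±4}`; hence for all `θ ∈ [π/3, 2π/3]`: `Y = t^{−8q}X`
  (`gmObservable_slot_reverse_printed`), `VF_D(w.side σ, w) = 2v(θ)c_{σ.opp}t^{−4q}·X`
  (`vertexFunctional_printed_isthmus_root_eq_slot`), `‖VF‖ = 2|v(θ)|‖X‖`.
* (3d/3e) the same on the complexified curve at the printed spin (F4's setting) and at every admissible spin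
  modulo `CurveIdentityAt t r` (F8's theorem).
* (3f) `slot_winding_eq`: every slot-crossing walk winds exactly `∓2π` (the tree's `ExcursionWindingGen` at the
  outer root) ⇒ `t^{q(δ)} = t^{4q}` (`tFiveEighths_zpow_slot`), `X = t^{4q}·Σ_δ weightL(δ)`.
* (3g) **`vertexFunctional_printed_isthmus_root_eq_real`: `VF_D(w.side σ, w) = 2·v(θ)·c_{σ.opp}·B`**,
  `‖VF‖ = 2v(θ)B`, `VF = 0 ↔ B = 0`, `B = slotWeightSum θ Dl w σ ≥ 0` the total weight of the walks of
  `D ∖ {w}` joining the two sides of the slot.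
* (3h) on `θ ∈ (π/3, 2π/3)`: `VF ≠ 0 ↔` some walk of `D ∖ {w}` joins the two sides of the slot
  (`vertexFunctional_printed_isthmus_root_ne_zero_iff_nonempty`).
* (3b) `‖VF‖ = (2 − √2)·B` at `θ = π/3`; pinch corollaries (`isEmpty_slot_of_outerRoot_both`).
* (3i) **the ring theorem `vertexFunctional_printed_ring_hole_ne_zero`**: if the seven king-neighbours of the
  missing plaquette other than `w` lie in `Dl`, the identity FAILS at `w` for every `θ ∈ (π/3, 2π/3)`
  (explicit ring walk `ringWalk`).

Status in print: no printed source states a defect law at hole roots; Duminil-Copin–Smirnov name the failing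
step («we used the fact that a is on the boundary and Ω is simply connected», Lemma 1) and
Beaton–Bousquet-Mélou–de Gier–Duminil-Copin–Guttmann's Lemma 3, eq. (7) is the printed SHAPE of such a defect
bookkeeping (surface-weight defect = slot-crossing partition functions × local coefficients) — NEW-IN-WRITING,
modest (to be confirmed by the literature seat). [cite: GlazmanManolescu2019, Lemma 2.1]
[cite: DuminilCopinSmirnov2012, Lemma 1] [cite: Glazman2015WeightedSAW, Lemma 3.1]
-/

noncomputable section

open Real

namespace Literature.Barriers.CriticalPhenomena.PlaquetteWalk

open Literature.Probability.RandomPlanarGeometry.SAW.YangBaxter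
open Literature.Probability.RandomPlanarGeometry.SAW.YangBaxter.MidEdge
open Literature.Probability.RandomPlanarGeometry.SAW

/-! ### Plumbing re-proved from `PlaquetteWalkIsthmusRoot` (private there) -/

section Plumbing

variable {Dl : List Face} {w : Face} {σ : Side} {z : MidEdge}

/-- A side's opposite's opposite. [folklore] -/
private theorem Side.opp_opp (s : Side) : s.opp.opp = s := by cases s <;> rfl

/-- A side differs from its opposite. [folklore] -/
private theorem Side.opp_ne_self (s : Side) : s.opp ≠ s := by cases s <;> decide

/-- The four sides seen from `σ` are pairwise distinct. [folklore] -/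
private theorem lat_facts (σ : Side) :
    lat σ ≠ σ ∧ lat σ ≠ σ.opp ∧ (lat σ).opp ≠ σ ∧ (lat σ).opp ≠ σ.opp ∧ (lat σ).opp ≠ lat σ ∧ σ.opp ≠ σ := by
  cases σ <;> decide

/-- Sums over the two lateral sides. [folklore] -/
private theorem sum_lat (σ : Side) (g : Side → ℂ) :
    ∑ u ∈ (Finset.univ.erase σ).erase σ.opp, g u = g (lat σ) + g (lat σ).opp := by
  cases σ
  · rw [show ((Finset.univ.erase Side.W).erase (Side.opp .W) : Finset Side) = {Side.S, Side.N} from by decide,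
      Finset.sum_pair (by decide)]; rfl
  · rw [show ((Finset.univ.erase Side.E).erase (Side.opp .E) : Finset Side) = {Side.S, Side.N} from by decide,
      Finset.sum_pair (by decide)]; rfl
  · rw [show ((Finset.univ.erase Side.S).erase (Side.opp .S) : Finset Side) = {Side.W, Side.E} from by decide,
      Finset.sum_pair (by decide)]; rfl
  · rw [show ((Finset.univ.erase Side.N).erase (Side.opp .N) : Finset Side) = {Side.W, Side.E} from by decide,
      Finset.sum_pair (by decide)]; rfl

/-- Membership in the face list with `w` removed. [folklore] -/
private theorem mem_eraseFace {Dl : List Face} {w f : Face} : f ∈ eraseFace Dl w ↔ f ∈ Dl ∧ f ≠ w := by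
  simp [eraseFace]

/-- The two plaquettes of the side `s` of `w` are `w` and `nbr w s`. [folklore] -/
private theorem faces_side_eq (w : Face) (s : Side) :
    (w.side s).faces = (nbr w s, w) ∨ (w.side s).faces = (w, nbr w s) := by
  obtain ⟨x, y⟩ := w
  cases s <;> simp [Face.side, MidEdge.faces, nbr]

/-- A plaquette having `w.side s` as a side is `w` or the plaquette across. [folklore] -/
private theorem eq_or_eq_nbr_of_faces {w f : Face} {s : Side}
    (h : f = (w.side s).faces.1 ∨ f = (w.side s).faces.2) : f = w ∨ f = nbr w s := by
  rcases faces_side_eq w s with e | e <;> rw [e] at h <;> tauto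

/-- The plaquette across the outer side is not in the domain. [cite: GlazmanManolescu2019, §2.1 (walks start on the boundary)] -/
private theorem nbr_opp_not_mem (hw : w ∈ Dl) (hO : OuterRoot (dom Dl) (w.side σ.opp)) : nbr w σ.opp ∉ dom Dl := by
  obtain ⟨n, g, ⟨s₀, hs₀⟩, hD, -, -⟩ := hO
  rcases eq_or_eq_nbr_of_faces ((Face.exists_side_eq_iff (g 0) (w.side σ.opp)).1 ⟨s₀, hs₀⟩) with h | h
  · exact absurd (h ▸ (hw : w ∈ dom Dl)) (hD 0 (Nat.zero_le _))
  · exact h ▸ hD 0 (Nat.zero_le _)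

/-- The arcs of a list with two explicit first entries. [folklore] -/
private theorem arcsOf_cons_cons (a e : MidEdge) (rest : List MidEdge) :
    arcsOf (a :: e :: rest) = (a, e) :: arcsOf (e :: rest) := rfl

/-- The mid-edges of the prepended walk. [folklore] -/
private theorem consWalk_mids (hw : w ∈ Dl) (hh : nbr w σ ∉ dom Dl) {s : Side} (hs : s ≠ σ)
    (δ : YBWalk (dom (eraseFace Dl w)) (w.side s) z) : (consWalk hw hh hs δ).mids = w.side σ :: δ.mids := by
  rw [consWalk, YBWalk.cast_mids, YBWalk.ofFn_mids]
  apply List.ext_getElem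
  · rw [List.length_ofFn, List.length_cons, δ.length_eq]
  · intro i h1 h2
    rw [List.getElem_ofFn]
    cases i with
    | zero => rfl
    | succ i =>
      rw [List.getElem_cons_succ, ← δ.nth_eq_getElem]
      rfl

/-- A walk of the domain with `w` removed does not cross the missing side `w.side σ`. [folklore] -/
private theorem nth_ne_root (hh : nbr w σ ∉ dom Dl) {s : Side} (hs : s ≠ σ) (δ : YBWalk (dom (eraseFace Dl w)) (w.side s) z)
    {i : ℕ} (hi : i ≤ δ.arcs.length) : δ.nth i ≠ w.side σ := by
  intro e
  have hface : ∀ {p : MidEdge × MidEdge} {f : Face}, f ∈ dom (eraseFace Dl w) → arcFace p = some f →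
      p.1 ≠ w.side σ ∧ p.2 ≠ w.side σ := by
    intro p f hf hp
    obtain ⟨x, y⟩ := p
    obtain ⟨-, h1, h2⟩ := MidEdge.commonFace_eq_some hp
    constructor
    · rintro rfl
      rcases eq_or_eq_nbr_of_faces h1 with rfl | rfl
      · exact (mem_eraseFace.1 hf).2 rfl
      · exact hh (mem_eraseFace.1 hf).1
    · rintro rfl
      rcases eq_or_eq_nbr_of_faces h2 with rfl | rfl
      · exact (mem_eraseFace.1 hf).2 rfl
      · exact hh (mem_eraseFace.1 hf).1
  rcases Nat.eq_zero_or_pos δ.arcs.length with hlen | hpos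
  · have e0 : δ.nth i = w.side s := by rw [show i = 0 by omega, δ.nth_zero]
    exact hs (Face.side_injective w (e0.symm.trans e))
  · rcases Nat.lt_or_ge i δ.arcs.length with hlt | hge
    · obtain ⟨f, hfD, hf⟩ := δ.arc_nth hlt
      exact (hface hfD hf).1 e
    · obtain ⟨f, hfD, hf⟩ := δ.arc_nth (i := i - 1) (by omega)
      rw [show i - 1 + 1 = i from by omega] at hf
      exact (hface hfD hf).2 e

/-- A walk between two different sides has an arc. [folklore] -/
private theorem arcs_pos_of_lateral {s : Side} (δ : YBWalk (dom (eraseFace Dl w)) (w.side s) (w.side s.opp)) :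
    0 < δ.arcs.length := by
  by_contra h0
  have e := δ.nth_length
  rw [show δ.arcs.length = 0 by omega, δ.nth_zero] at e
  exact Side.opp_ne_self s (Face.side_injective w e).symm

end Plumbing

end Literature.Barriers.CriticalPhenomena.PlaquetteWalk

/-! ## Part 3 — the slot relation and the proportionality of the hole defect (venture lane «pcv-sawmu», b-step0 gen 13)

Two algebraic consequences of Part 2 (`vertexFunctional_isthmus_root`) applied at BOTH roots of an
isthmus plaquette `w` — the hole root `w.side σ` and the outer root `w.side σ.opp` — together with
C-B2 (`vertexFunctional_printed_eq_zero`) at the outer root. Write `ℓ = lat σ` for one lateral side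
(the other is `ℓ.opp`), `X = G_{D∖w}(w.side ℓ → w.side ℓ.opp)` and `Y = G_{D∖w}(w.side ℓ.opp → w.side ℓ)`
for the two boundary-to-boundary observables of `D ∖ {w}` across the slot, and `dc(ρ, s)` for
`defectCoeff (printedWeights θ) t (ybCoeff θ) ρ s`.

* `slot_relation_printed` (★): `dc(σ.opp, ℓ)·X + dc(σ.opp, ℓ.opp)·Y = 0` — the functional at `w` from
  the OUTER root vanishes (C-B2) and Part 2 expands it over the same `X`, `Y`;
* `vertexFunctional_printed_isthmus_root_eq_single` (★★): eliminating `Y`, the hole defect is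
  proportional to ONE slot observable: `dc(σ.opp, ℓ.opp) · VF_D(w.side σ, w) = defectDet(σ) · X` with
  `defectDet(σ) = dc(σ,ℓ)·dc(σ.opp,ℓ.opp) − dc(σ,ℓ.opp)·dc(σ.opp,ℓ)`;
* `vertexFunctional_printed_isthmus_root_eq_zero_iff`: where the two local constants are nonzero, the
  Yang–Baxter vertex identity holds at the root plaquette of an isthmus hole root IFF `X = 0`.

Lane numerics (exact in ℚ(ζ₃₂); HOME/code/step0/g13/part3/): (★)/(★★) hold at every isthmus root of
the holed test domains at the printed point and three off-circle points of the YB curve (as they must);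
`defectDet ≠ 0`, `dc(σ.opp,ℓ.opp) ≠ 0` there; at the hexagonal point `θ = π/3` every `dc` is a unit
times `x_c²`, `|defectDet| = 2x_c⁴` and `|VF_D(w.side σ, w)| = (2 − √2)·|X|`; and `X ≠ 0` throughout
(every slot-crossing walk has the same winding, ∓4 quarter turns — it goes around the hole — so
`−dc(σ.opp,ℓ)/dc(σ.opp,ℓ.opp) = t^{±8} = ∓i`, as observed).
-/

namespace Literature.Barriers.CriticalPhenomena.PlaquetteWalk

open Literature.Probability.RandomPlanarGeometry.SAW.YangBaxter
open Literature.Probability.RandomPlanarGeometry.SAW.YangBaxter.MidEdge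

section SlotRelation

variable {Dl : List Face} {w : Face} {σ : Side}

/-- The lateral sides of `σ.opp` are those of `σ`. [folklore] -/
private theorem laterals_opp (σ : Side) :
    (Finset.univ.erase σ.opp).erase σ.opp.opp = (Finset.univ.erase σ).erase σ.opp := by
  cases σ <;> decide

/-- **Part 2 at the opposite root** (general weights): if the plaquettes across `σ` and across `σ.opp`
are both missing, the vertex functional at `w` from the OPPOSITE root `w.side σ.opp` is the
one-plaquette functional plus the defect sum with the coefficients `defectCoeff … σ.opp s`, over the
SAME two slot observables of `D ∖ {w}` (indexed by the lateral sides of `σ`).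
[cite: GlazmanManolescu2019, Lemma 2.1 (statement, "in the form given in [Gl]"); Glazman2015WeightedSAW, Lemma 3.1 (proof: grouping of walks at one rhombus)] -/
theorem vertexFunctional_isthmus_root_opp (W : CWeights) {t : ℂ} (ht : t ≠ 0) (c : Fin 4 → ℂ) (hw : w ∈ Dl)
    (hh : nbr w σ ∉ dom Dl) (ho : nbr w σ.opp ∉ dom Dl) :
    vertexFunctional W t c Dl (w.side σ.opp) w = vertexFunctional W t c [w] (w.side σ.opp) w +
      ∑ s ∈ (Finset.univ.erase σ).erase σ.opp,
        defectCoeff W t c σ.opp s * gmObservable W t (eraseFace Dl w) (w.side s) (w.side s.opp) := by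
  have hh' : nbr w σ.opp.opp ∉ dom Dl := by rw [Side.opp_opp]; exact hh
  rw [vertexFunctional_isthmus_root W ht c hw ho hh', laterals_opp]

/-- ★ **The slot relation** (printed Yang–Baxter weights, `θ ∈ [π/3, 2π/3]`): at an isthmus plaquette
`w` (plaquette across `σ` missing, `w.side σ.opp` an OUTER root of `D`), the two boundary-to-boundary
observables of `D ∖ {w}` across the slot satisfy one universal linear relation:
`Σ_{s lateral} defectCoeff(σ.opp, s) · G_{D∖w}(w.side s → w.side s.opp) = 0`. Proof: C-B2 kills the
functional at `w` from the outer root `w.side σ.opp` (in `D` and in `[w]`), and Part 2 at that root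
expands it. [cite: GlazmanManolescu2019, Lemma 2.1, eq. (2.2) (CR)] [cite: DuminilCopinSmirnov2012, Lemma 1] -/
theorem slot_relation_printed {θ : ℝ} (hθ : θ ∈ Set.Icc (π / 3) (2 * π / 3)) (Dl : List Face) (w : Face)
    (σ : Side) (hw : w ∈ Dl) (hh : nbr w σ ∉ dom Dl) (hO : OuterRoot (dom Dl) (w.side σ.opp)) :
    ∑ s ∈ (Finset.univ.erase σ).erase σ.opp, defectCoeff (printedWeights θ) tFiveEighths (ybCoeff θ) σ.opp s *
        gmObservable (printedWeights θ) tFiveEighths (eraseFace Dl w) (w.side s) (w.side s.opp) = 0 := by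
  have h := vertexFunctional_isthmus_root_opp (printedWeights θ) tFiveEighths_ne_zero (ybCoeff θ) hw hh
    (nbr_opp_not_mem hw hO)
  rw [vertexFunctional_printed_eq_zero hθ Dl (w.side σ.opp) hO w hw,
    vertexFunctional_printed_eq_zero hθ [w] (w.side σ.opp) (outerRoot_single w σ.opp) w
      (List.mem_singleton.2 rfl), zero_add] at h
  exact h.symm

/-- ★ **The slot relation, two-term form** (`ℓ = lat σ`; the other lateral side is `ℓ.opp`):
`defectCoeff(σ.opp, ℓ)·G_{D∖w}(w.side ℓ → w.side ℓ.opp) + defectCoeff(σ.opp, ℓ.opp)·G_{D∖w}(w.side ℓ.opp → w.side ℓ) = 0`.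
[cite: GlazmanManolescu2019, Lemma 2.1, eq. (2.2) (CR)] -/
theorem slot_relation_printed_lat {θ : ℝ} (hθ : θ ∈ Set.Icc (π / 3) (2 * π / 3)) (Dl : List Face) (w : Face)
    (σ : Side) (hw : w ∈ Dl) (hh : nbr w σ ∉ dom Dl) (hO : OuterRoot (dom Dl) (w.side σ.opp)) :
    defectCoeff (printedWeights θ) tFiveEighths (ybCoeff θ) σ.opp (lat σ) *
        gmObservable (printedWeights θ) tFiveEighths (eraseFace Dl w) (w.side (lat σ)) (w.side (lat σ).opp) +
      defectCoeff (printedWeights θ) tFiveEighths (ybCoeff θ) σ.opp (lat σ).opp *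
        gmObservable (printedWeights θ) tFiveEighths (eraseFace Dl w) (w.side (lat σ).opp) (w.side (lat σ)) = 0 := by
  have h := slot_relation_printed hθ Dl w σ hw hh hO
  rw [sum_lat] at h
  simpa only [Side.opp_opp] using h

/-- **The determinant of the defect coefficients at the two roots of an isthmus plaquette** (hole side
`σ`, lateral side `ℓ = lat σ`): `defectCoeff(σ,ℓ)·defectCoeff(σ.opp,ℓ.opp) − defectCoeff(σ,ℓ.opp)·defectCoeff(σ.opp,ℓ)`.
[cite: GlazmanManolescu2019, Lemma 2.1 (statement, "in the form given in [Gl]"); Glazman2015WeightedSAW, Lemma 3.1 (proof: the coefficients of the groups at one rhombus)] -/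
def defectDet (W : CWeights) (t : ℂ) (c : Fin 4 → ℂ) (σ : Side) : ℂ :=
  defectCoeff W t c σ (lat σ) * defectCoeff W t c σ.opp (lat σ).opp -
    defectCoeff W t c σ (lat σ).opp * defectCoeff W t c σ.opp (lat σ)

/-- ★★ **The hole defect is proportional to ONE slot observable** (printed Yang–Baxter weights,
`θ ∈ [π/3, 2π/3]`, isthmus plaquette `w` with the hole across `σ` and `w.side σ.opp` an outer root):
`defectCoeff(σ.opp, ℓ.opp) · VF_D(w.side σ, w) = defectDet(σ) · G_{D∖w}(w.side ℓ → w.side ℓ.opp)`, `ℓ = lat σ`.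
Proof: Part 2 at the hole root gives `VF = dc(σ,ℓ)X + dc(σ,ℓ.opp)Y`; eliminate `Y` with the slot relation.
[cite: GlazmanManolescu2019, Lemma 2.1 (statement, "in the form given in [Gl]"); Glazman2015WeightedSAW, Lemma 3.1 (proof)] [cite: DuminilCopinSmirnov2012, proof of Lemma 1 («we used the fact that a is on the boundary and Ω is simply connected»)] -/
theorem vertexFunctional_printed_isthmus_root_eq_single {θ : ℝ} (hθ : θ ∈ Set.Icc (π / 3) (2 * π / 3))
    (Dl : List Face) (w : Face) (σ : Side) (hw : w ∈ Dl) (hh : nbr w σ ∉ dom Dl)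
    (hO : OuterRoot (dom Dl) (w.side σ.opp)) :
    defectCoeff (printedWeights θ) tFiveEighths (ybCoeff θ) σ.opp (lat σ).opp *
        vertexFunctional (printedWeights θ) tFiveEighths (ybCoeff θ) Dl (w.side σ) w =
      defectDet (printedWeights θ) tFiveEighths (ybCoeff θ) σ *
        gmObservable (printedWeights θ) tFiveEighths (eraseFace Dl w) (w.side (lat σ)) (w.side (lat σ).opp) := by
  have hs := slot_relation_printed_lat hθ Dl w σ hw hh hO
  rw [vertexFunctional_printed_isthmus_root hθ Dl w σ hw hh hO, sum_lat]
  simp only [Side.opp_opp, defectDet]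
  linear_combination defectCoeff (printedWeights θ) tFiveEighths (ybCoeff θ) σ (lat σ).opp * hs

/-- **Corollary**: where the two local constants `defectDet(σ)` and `defectCoeff(σ.opp, ℓ.opp)` are
nonzero, the Yang–Baxter vertex identity holds at the root plaquette of an isthmus hole root IF AND ONLY
IF the slot observable `G_{D∖w}(w.side ℓ → w.side ℓ.opp)` vanishes. (At genuine hole roots it does not:
every walk of `D ∖ {w}` between the lateral sides goes around the hole — lane numerics.)
[cite: DuminilCopinSmirnov2012, proof of Lemma 1 (rôle of simple connectivity)] -/
theorem vertexFunctional_printed_isthmus_root_eq_zero_iff {θ : ℝ} (hθ : θ ∈ Set.Icc (π / 3) (2 * π / 3))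
    (Dl : List Face) (w : Face) (σ : Side) (hw : w ∈ Dl) (hh : nbr w σ ∉ dom Dl)
    (hO : OuterRoot (dom Dl) (w.side σ.opp)) (hdet : defectDet (printedWeights θ) tFiveEighths (ybCoeff θ) σ ≠ 0)
    (hdc : defectCoeff (printedWeights θ) tFiveEighths (ybCoeff θ) σ.opp (lat σ).opp ≠ 0) :
    vertexFunctional (printedWeights θ) tFiveEighths (ybCoeff θ) Dl (w.side σ) w = 0 ↔
      gmObservable (printedWeights θ) tFiveEighths (eraseFace Dl w) (w.side (lat σ)) (w.side (lat σ).opp) = 0 := by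
  have h := vertexFunctional_printed_isthmus_root_eq_single hθ Dl w σ hw hh hO
  constructor
  · intro h0
    rw [h0, mul_zero] at h
    exact (mul_eq_zero.1 h.symm).resolve_left hdet
  · intro h0
    rw [h0, mul_zero] at h
    exact (mul_eq_zero.1 h).resolve_left hdc

end SlotRelation

end Literature.Barriers.CriticalPhenomena.PlaquetteWalk

/-! ## Part 3c — the constants on the whole printed range (and on the curve): the defect coefficients are MONOMIALS

On the Yang–Baxter curve `W = ybCurve (−1) t r`, `c = oddCoeff r = (1, r, −1, −r)`, the eight defect
coefficients collapse to monomials `± v t^{±4}` (hole side `W`/`E`) and `± r v t^{±4}` (hole side `S`/`N`)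
— the two-co-corner relation `w₂t = vt⁵ − u₂r` and the two-corner relation `w₁t⁴ = v + u₁t⁵r` of the
curve for the sides `W`/`E`, the full closed forms for `S`/`N` (`defectCoeff_ybCurve_values`). Since the
printed weights ARE the curve point `ybCurve (−1) e^{−5iπ/16} r(θ)` (`printedWeights_eq_ybCurve`, tree),
this gives, for EVERY `θ ∈ [π/3, 2π/3]`, every finite face list and every isthmus hole root
(`ℓ = lat σ`, `q = qTurn σ ℓ = ∓1`, `X = G_{D∖w}(w.side ℓ → w.side ℓ.opp)`, `Y` the reverse):
* ★★ the SLOT REVERSAL LAW `Y = t^{−8q} · X` (`gmObservable_slot_reverse_printed`);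
* ★★★ the HOLE DEFECT LAW `VF_D(w.side σ, w) = 2 v(θ) c_{σ.opp} t^{−4q} · X`
  (`vertexFunctional_printed_isthmus_root_eq_slot`), hence `VF = 0 ↔ X = 0` and
  **`‖VF_D(w.side σ, w)‖ = 2 v(θ) ‖X‖`** (`v(θ) = weightV θ > 0`; at `θ = π/3`, `2v = 2x_c² = 2 − √2`,
  recovering Part 3b).
-/

namespace Literature.Barriers.CriticalPhenomena.PlaquetteWalk

open Literature.Probability.RandomPlanarGeometry.SAW.YangBaxter
open Literature.Probability.RandomPlanarGeometry.SAW.YangBaxter.MidEdge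
open Literature.Probability.RandomPlanarGeometry.SAW

section Curve

variable {t r : ℂ}

/-- `t⁴ − 1 ≠ 0`. [folklore] -/
private theorem t4_sub_one_ne_zero₃ (ht4 : t ^ 4 ≠ 1) : t ^ 4 - 1 ≠ 0 :=
  fun h => ht4 (by linear_combination h)

/-- The curve's denominator in the form `field_simp` produces. [folklore] -/
private theorem den_ne_zero₃ (hD : t ^ 6 * (1 + r ^ 4) - (1 + t ^ 12) * r ^ 2 ≠ 0) :
    t ^ 6 * (1 + r ^ 4) - r ^ 2 * (1 + t ^ 12) ≠ 0 :=
  fun h => hD (by linear_combination h)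

/-- `(−1)·r·(t⁴ − 1) ≠ 0` (the denominator of `u₁`). [folklore] -/
private theorem u1den_ne_zero₃ (ht4 : t ^ 4 ≠ 1) (hr : r ≠ 0) : (-1 : ℂ) * r * (t ^ 4 - 1) ≠ 0 :=
  mul_ne_zero (mul_ne_zero (by norm_num) hr) (t4_sub_one_ne_zero₃ ht4)

/-- `c₀ = 1`. [folklore] -/
private theorem oc0₃ (r : ℂ) : oddCoeff r 0 = 1 := rfl
/-- `c₁ = r`. [folklore] -/
private theorem oc1₃ (r : ℂ) : oddCoeff r 1 = r := rfl
/-- `c₂ = −1`. [folklore] -/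
private theorem oc2₃ (r : ℂ) : oddCoeff r 2 = -1 := rfl
/-- `c₃ = −r`. [folklore] -/
private theorem oc3₃ (r : ℂ) : oddCoeff r 3 = -r := rfl

/-- `t^{1−1} = 1`. [folklore] -/
private theorem zpow_one_neg_one₃ (t : ℂ) : t ^ ((1 : ℤ) + (-1 : ℤ)) = 1 := by norm_num
/-- `t^{−1+1} = 1`. [folklore] -/
private theorem zpow_neg_one_one₃ (t : ℂ) : t ^ ((-1 : ℤ) + (1 : ℤ)) = 1 := by norm_num

/-- ★ **The defect coefficients on the Yang–Baxter curve are monomials**: for `W = ybCurve (−1) t r`,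
`c = (1, r, −1, −r)` (`t ≠ 0`, `t⁴ ≠ 1`, `r ≠ 0`, curve denominator `≠ 0`), with `v = ybV (−1) t r`:
`dc(W,S) = vt⁴`, `dc(W,N)t⁴ = v`, `dc(E,S)t⁴ = −v`, `dc(E,N) = −vt⁴`, `dc(S,W)t⁴ = rv`, `dc(S,E) = rvt⁴`,
`dc(N,W) = −rvt⁴`, `dc(N,E)t⁴ = −rv`. [cite: GlazmanManolescu2019, eq. (1) (the curve), Lemma 2.1 (statement, "in the form given in [Gl]")]
[cite: Glazman2015WeightedSAW, Lemma 3.1, Appendix (the triangular system)] -/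
theorem defectCoeff_ybCurve_values (ht : t ≠ 0) (ht4 : t ^ 4 ≠ 1) (hr : r ≠ 0)
    (hD : t ^ 6 * (1 + r ^ 4) - (1 + t ^ 12) * r ^ 2 ≠ 0) :
    defectCoeff (ybCurve (-1) t r) t (oddCoeff r) .W .S = ybV (-1) t r * t ^ 4 ∧
    defectCoeff (ybCurve (-1) t r) t (oddCoeff r) .W .N * t ^ 4 = ybV (-1) t r ∧
    defectCoeff (ybCurve (-1) t r) t (oddCoeff r) .E .S * t ^ 4 = -ybV (-1) t r ∧
    defectCoeff (ybCurve (-1) t r) t (oddCoeff r) .E .N = -(ybV (-1) t r * t ^ 4) ∧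
    defectCoeff (ybCurve (-1) t r) t (oddCoeff r) .S .W * t ^ 4 = r * ybV (-1) t r ∧
    defectCoeff (ybCurve (-1) t r) t (oddCoeff r) .S .E = r * ybV (-1) t r * t ^ 4 ∧
    defectCoeff (ybCurve (-1) t r) t (oddCoeff r) .N .W = -(r * ybV (-1) t r * t ^ 4) ∧
    defectCoeff (ybCurve (-1) t r) t (oddCoeff r) .N .E * t ^ 4 = -(r * ybV (-1) t r) := by
  have ht4' := t4_sub_one_ne_zero₃ ht4
  have hD' := den_ne_zero₃ hD
  have hu := u1den_ne_zero₃ ht4 hr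
  refine ⟨?_, ?_, ?_, ?_, ?_, ?_, ?_, ?_⟩
  · change oddCoeff r 1 * ((ybCurve (-1) t r).u₂ * t ^ (-1 : ℤ)) +
      oddCoeff r 0 * ((ybCurve (-1) t r).w₂ * t ^ ((-1 : ℤ) + (1 : ℤ))) = _
    rw [oc1₃, oc0₃, zpow_neg_one, zpow_neg_one_one₃]
    simp only [ybCurve, ybW2]
    field_simp
    ring
  · change (oddCoeff r 3 * ((ybCurve (-1) t r).u₁ * t ^ (1 : ℤ)) +
      oddCoeff r 0 * ((ybCurve (-1) t r).w₁ * t ^ ((1 : ℤ) + (-1 : ℤ)))) * t ^ 4 = _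
    rw [oc3₃, oc0₃, zpow_one, zpow_one_neg_one₃]
    simp only [ybCurve, ybW1]
    field_simp
    ring
  · change (oddCoeff r 1 * ((ybCurve (-1) t r).u₁ * t ^ (1 : ℤ)) +
      oddCoeff r 2 * ((ybCurve (-1) t r).w₁ * t ^ ((1 : ℤ) + (-1 : ℤ)))) * t ^ 4 = _
    rw [oc1₃, oc2₃, zpow_one, zpow_one_neg_one₃]
    simp only [ybCurve, ybW1]
    field_simp
    ring
  · change oddCoeff r 3 * ((ybCurve (-1) t r).u₂ * t ^ (-1 : ℤ)) +
      oddCoeff r 2 * ((ybCurve (-1) t r).w₂ * t ^ ((-1 : ℤ) + (1 : ℤ))) = _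
    rw [oc3₃, oc2₃, zpow_neg_one, zpow_neg_one_one₃]
    simp only [ybCurve, ybW2]
    field_simp
    ring
  · change (oddCoeff r 0 * ((ybCurve (-1) t r).u₂ * t ^ (1 : ℤ)) +
      oddCoeff r 1 * ((ybCurve (-1) t r).w₂ * t ^ ((1 : ℤ) + (-1 : ℤ)))) * t ^ 4 = _
    rw [oc0₃, oc1₃, zpow_one, zpow_one_neg_one₃]
    simp only [ybCurve, ybW2, ybU2, ybU1, ybV]
    field_simp
    ring
  · change oddCoeff r 2 * ((ybCurve (-1) t r).u₁ * t ^ (-1 : ℤ)) +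
      oddCoeff r 1 * ((ybCurve (-1) t r).w₁ * t ^ ((-1 : ℤ) + (1 : ℤ))) = _
    rw [oc2₃, oc1₃, zpow_neg_one, zpow_neg_one_one₃]
    simp only [ybCurve, ybW1, ybU1, ybV]
    field_simp
    ring
  · change oddCoeff r 0 * ((ybCurve (-1) t r).u₁ * t ^ (-1 : ℤ)) +
      oddCoeff r 3 * ((ybCurve (-1) t r).w₁ * t ^ ((-1 : ℤ) + (1 : ℤ))) = _
    rw [oc0₃, oc3₃, zpow_neg_one, zpow_neg_one_one₃]
    simp only [ybCurve, ybW1, ybU1, ybV]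
    field_simp
    ring
  · change (oddCoeff r 2 * ((ybCurve (-1) t r).u₂ * t ^ (1 : ℤ)) +
      oddCoeff r 3 * ((ybCurve (-1) t r).w₂ * t ^ ((1 : ℤ) + (-1 : ℤ)))) * t ^ 4 = _
    rw [oc2₃, oc3₃, zpow_one, zpow_one_neg_one₃]
    simp only [ybCurve, ybW2, ybU2, ybU1, ybV]
    field_simp
    ring

end Curve

section PrintedRange

/-- `c₀ = 1`. [folklore] -/
private theorem ybc0₃ (θ : ℝ) : ybCoeff θ 0 = 1 := rfl
/-- `c₁ = r`. [folklore] -/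
private theorem ybc1₃ (θ : ℝ) : ybCoeff θ 1 = ybRatio θ := rfl
/-- `c₂ = −1`. [folklore] -/
private theorem ybc2₃ (θ : ℝ) : ybCoeff θ 2 = -1 := rfl
/-- `c₃ = −r`. [folklore] -/
private theorem ybc3₃ (θ : ℝ) : ybCoeff θ 3 = -ybRatio θ := rfl

/-- **`v(θ) ≠ 0` on the printed range** (indeed `v > 0`: `sin(5π/8 + 3θ/8) > 0`, `sin(−3θ/8) < 0`, and the
denominator is negative). [cite: GlazmanManolescu2019, eq. (1)] -/
theorem weightV_ne_zero_of_mem {θ : ℝ} (hθ : θ ∈ Set.Icc (π / 3) (2 * π / 3)) : weightV θ ≠ 0 := by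
  have hden := weightDen_ne_zero_of_mem hθ
  obtain ⟨h1, h2⟩ := hθ
  unfold weightV
  refine div_ne_zero (mul_ne_zero ?_ ?_) hden
  · exact (Real.sin_pos_of_pos_of_lt_pi (by linarith [Real.pi_pos]) (by linarith [Real.pi_pos])).ne'
  · rw [Real.sin_neg]
    exact neg_ne_zero.2 (Real.sin_pos_of_pos_of_lt_pi (by linarith [Real.pi_pos]) (by linarith [Real.pi_pos])).ne'

/-- `t⁴ ≠ 1` for `t = e^{−5iπ/16}` (else `t¹⁶ = 1`). [folklore] -/
private theorem tFiveEighths_pow_four_ne_one₃ : tFiveEighths ^ 4 ≠ 1 := by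
  intro h
  have h16 := tFiveEighths_pow_sixteen
  rw [show (16 : ℕ) = 4 * 4 from rfl, pow_mul, h, one_pow] at h16
  norm_num at h16

/-- `v(θ)` in the curve's coordinates: `ybV (−1) t r(θ) = v(θ)`. [cite: GlazmanManolescu2019, eq. (1)] -/
private theorem ybV_printed₃ {θ : ℝ} (hθ : θ ∈ Set.Icc (π / 3) (2 * π / 3)) :
    ybV (-1) tFiveEighths (ybRatio θ) = (weightV θ : ℂ) :=
  (congrArg CWeights.v (printedWeights_eq_ybCurve θ (weightDen_ne_zero_of_mem hθ))).symm

/-- The curve's denominator at `(e^{−5iπ/16}, r(θ))` is nonzero on the printed range (else `v(θ) = 0`).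
[cite: GlazmanManolescu2019, eq. (1)] -/
private theorem printed_den_ne_zero₃ {θ : ℝ} (hθ : θ ∈ Set.Icc (π / 3) (2 * π / 3)) :
    tFiveEighths ^ 6 * (1 + ybRatio θ ^ 4) - (1 + tFiveEighths ^ 12) * ybRatio θ ^ 2 ≠ 0 := by
  intro h
  have hv : (weightV θ : ℂ) ≠ 0 := Complex.ofReal_ne_zero.2 (weightV_ne_zero_of_mem hθ)
  rw [← ybV_printed₃ hθ] at hv
  exact hv (by unfold ybV; rw [h, div_zero])

/-- ★ **The printed defect coefficients, all `θ ∈ [π/3, 2π/3]`** (`t = e^{−5iπ/16}`, `r = r(θ)`,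
`v = v(θ)`): `dc(W,S) = vt⁴`, `dc(W,N)t⁴ = v`, `dc(E,S)t⁴ = −v`, `dc(E,N) = −vt⁴`, `dc(S,W)t⁴ = rv`,
`dc(S,E) = rvt⁴`, `dc(N,W) = −rvt⁴`, `dc(N,E)t⁴ = −rv`. [cite: GlazmanManolescu2019, eq. (1), Lemma 2.1 (statement, "in the form given in [Gl]"); Glazman2015WeightedSAW, Lemma 3.1 (proof)] -/
theorem defectCoeff_printed_values {θ : ℝ} (hθ : θ ∈ Set.Icc (π / 3) (2 * π / 3)) :
    defectCoeff (printedWeights θ) tFiveEighths (ybCoeff θ) .W .S = (weightV θ : ℂ) * tFiveEighths ^ 4 ∧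
    defectCoeff (printedWeights θ) tFiveEighths (ybCoeff θ) .W .N * tFiveEighths ^ 4 = (weightV θ : ℂ) ∧
    defectCoeff (printedWeights θ) tFiveEighths (ybCoeff θ) .E .S * tFiveEighths ^ 4 = -(weightV θ : ℂ) ∧
    defectCoeff (printedWeights θ) tFiveEighths (ybCoeff θ) .E .N = -((weightV θ : ℂ) * tFiveEighths ^ 4) ∧
    defectCoeff (printedWeights θ) tFiveEighths (ybCoeff θ) .S .W * tFiveEighths ^ 4 = ybRatio θ * (weightV θ : ℂ) ∧
    defectCoeff (printedWeights θ) tFiveEighths (ybCoeff θ) .S .E = ybRatio θ * (weightV θ : ℂ) * tFiveEighths ^ 4 ∧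
    defectCoeff (printedWeights θ) tFiveEighths (ybCoeff θ) .N .W = -(ybRatio θ * (weightV θ : ℂ) * tFiveEighths ^ 4) ∧
    defectCoeff (printedWeights θ) tFiveEighths (ybCoeff θ) .N .E * tFiveEighths ^ 4 = -(ybRatio θ * (weightV θ : ℂ)) := by
  rw [show ybCoeff θ = oddCoeff (ybRatio θ) from rfl, printedWeights_eq_ybCurve θ (weightDen_ne_zero_of_mem hθ),
    ← ybV_printed₃ hθ]
  exact defectCoeff_ybCurve_values tFiveEighths_ne_zero tFiveEighths_pow_four_ne_one₃ (ybRatio_ne_zero θ)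
    (printed_den_ne_zero₃ hθ)

/-- `t⁸` as an integer power. [folklore] -/
private theorem zt_eightP₃ : tFiveEighths ^ (8 : ℤ) = tFiveEighths ^ 8 := by
  rw [show (8 : ℤ) = ((8 : ℕ) : ℤ) from rfl, zpow_natCast]

/-- `t⁻⁸ = −t⁸` (`t¹⁶ = −1`). [folklore] -/
private theorem zt_neg_eightP₃ : tFiveEighths ^ (-8 : ℤ) = -tFiveEighths ^ 8 := by
  rw [show (-8 : ℤ) = -((8 : ℕ) : ℤ) from rfl, zpow_neg, zpow_natCast]
  exact inv_eq_of_mul_eq_one_right (by linear_combination (-1 : ℂ) * tFiveEighths_pow_sixteen)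

/-- `t⁴` as an integer power. [folklore] -/
private theorem zt_fourP₃ : tFiveEighths ^ (4 : ℤ) = tFiveEighths ^ 4 := by
  rw [show (4 : ℤ) = ((4 : ℕ) : ℤ) from rfl, zpow_natCast]

/-- `t⁻⁴ = −t¹²` (`t¹⁶ = −1`). [folklore] -/
private theorem zt_neg_fourP₃ : tFiveEighths ^ (-4 : ℤ) = -tFiveEighths ^ 12 := by
  rw [show (-4 : ℤ) = -((4 : ℕ) : ℤ) from rfl, zpow_neg, zpow_natCast]
  exact inv_eq_of_mul_eq_one_right (by linear_combination (-1 : ℂ) * tFiveEighths_pow_sixteen)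

/-- ★★ **The slot reversal law on the whole printed range**: for every `θ ∈ [π/3, 2π/3]`, every finite face
list and every isthmus plaquette `w` (plaquette across `σ` missing, `w.side σ.opp` an outer root), the
reversed slot observable is `t^{−8q}` times the direct one, `q = qTurn σ (lat σ) = ∓1`:
`G_{D∖w}(w.side ℓ.opp → w.side ℓ) = t^{−8·qTurn σ ℓ} · G_{D∖w}(w.side ℓ → w.side ℓ.opp)`. (The slot relation
with the monomial coefficients; the signature of reversing walks that all wind `4q` quarter turns.)
[cite: GlazmanManolescu2019, Lemma 2.1 (statement, "in the form given in [Gl]"); Glazman2015WeightedSAW, Lemma 3.1 (proof)] [cite: DuminilCopinSmirnov2012, proof of Lemma 1] -/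
theorem gmObservable_slot_reverse_printed {θ : ℝ} (hθ : θ ∈ Set.Icc (π / 3) (2 * π / 3)) (Dl : List Face)
    (w : Face) (σ : Side) (hw : w ∈ Dl) (hh : nbr w σ ∉ dom Dl) (hO : OuterRoot (dom Dl) (w.side σ.opp)) :
    gmObservable (printedWeights θ) tFiveEighths (eraseFace Dl w) (w.side (lat σ).opp) (w.side (lat σ)) =
      tFiveEighths ^ (-(8 : ℤ) * qTurn σ (lat σ)) *
        gmObservable (printedWeights θ) tFiveEighths (eraseFace Dl w) (w.side (lat σ)) (w.side (lat σ).opp) := by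
  have h16 := tFiveEighths_pow_sixteen
  have ht : tFiveEighths ≠ 0 := tFiveEighths_ne_zero
  have hv : (weightV θ : ℂ) ≠ 0 := Complex.ofReal_ne_zero.2 (weightV_ne_zero_of_mem hθ)
  have hr : ybRatio θ ≠ 0 := ybRatio_ne_zero θ
  obtain ⟨e1, e2, e3, e4, e5, e6, e7, e8⟩ := defectCoeff_printed_values hθ
  cases σ
  · set X := gmObservable (printedWeights θ) tFiveEighths (eraseFace Dl w) (w.side Side.S) (w.side Side.N)
    set Y := gmObservable (printedWeights θ) tFiveEighths (eraseFace Dl w) (w.side Side.N) (w.side Side.S)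
    have slot : defectCoeff (printedWeights θ) tFiveEighths (ybCoeff θ) .E .S * X +
        defectCoeff (printedWeights θ) tFiveEighths (ybCoeff θ) .E .N * Y = 0 :=
      slot_relation_printed_lat hθ Dl w .W hw hh hO
    rw [e4] at slot
    change Y = tFiveEighths ^ (-(8 : ℤ) * qTurn Side.W Side.S) * X
    rw [show (-(8 : ℤ)) * qTurn Side.W Side.S = 8 from by decide, zt_eightP₃]
    have hne : (weightV θ : ℂ) * tFiveEighths ^ 8 ≠ 0 := mul_ne_zero hv (pow_ne_zero _ ht)
    apply mul_left_cancel₀ hne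
    linear_combination (-tFiveEighths ^ 4) * slot + X * e3 + (-((weightV θ : ℂ) * X)) * h16
  · set X := gmObservable (printedWeights θ) tFiveEighths (eraseFace Dl w) (w.side Side.S) (w.side Side.N)
    set Y := gmObservable (printedWeights θ) tFiveEighths (eraseFace Dl w) (w.side Side.N) (w.side Side.S)
    have slot : defectCoeff (printedWeights θ) tFiveEighths (ybCoeff θ) .W .S * X +
        defectCoeff (printedWeights θ) tFiveEighths (ybCoeff θ) .W .N * Y = 0 :=
      slot_relation_printed_lat hθ Dl w .E hw hh hO
    rw [e1] at slot
    change Y = tFiveEighths ^ (-(8 : ℤ) * qTurn Side.E Side.S) * X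
    rw [show (-(8 : ℤ)) * qTurn Side.E Side.S = -8 from by decide, zt_neg_eightP₃]
    apply mul_left_cancel₀ hv
    linear_combination tFiveEighths ^ 4 * slot + (-Y) * e2
  · set X := gmObservable (printedWeights θ) tFiveEighths (eraseFace Dl w) (w.side Side.W) (w.side Side.E)
    set Y := gmObservable (printedWeights θ) tFiveEighths (eraseFace Dl w) (w.side Side.E) (w.side Side.W)
    have slot : defectCoeff (printedWeights θ) tFiveEighths (ybCoeff θ) .N .W * X +
        defectCoeff (printedWeights θ) tFiveEighths (ybCoeff θ) .N .E * Y = 0 :=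
      slot_relation_printed_lat hθ Dl w .S hw hh hO
    rw [e7] at slot
    change Y = tFiveEighths ^ (-(8 : ℤ) * qTurn Side.S Side.W) * X
    rw [show (-(8 : ℤ)) * qTurn Side.S Side.W = -8 from by decide, zt_neg_eightP₃]
    have hne : ybRatio θ * (weightV θ : ℂ) ≠ 0 := mul_ne_zero hr hv
    apply mul_left_cancel₀ hne
    linear_combination (-tFiveEighths ^ 4) * slot + Y * e8
  · set X := gmObservable (printedWeights θ) tFiveEighths (eraseFace Dl w) (w.side Side.W) (w.side Side.E)
    set Y := gmObservable (printedWeights θ) tFiveEighths (eraseFace Dl w) (w.side Side.E) (w.side Side.W)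
    have slot : defectCoeff (printedWeights θ) tFiveEighths (ybCoeff θ) .S .W * X +
        defectCoeff (printedWeights θ) tFiveEighths (ybCoeff θ) .S .E * Y = 0 :=
      slot_relation_printed_lat hθ Dl w .N hw hh hO
    rw [e6] at slot
    change Y = tFiveEighths ^ (-(8 : ℤ) * qTurn Side.N Side.W) * X
    rw [show (-(8 : ℤ)) * qTurn Side.N Side.W = 8 from by decide, zt_eightP₃]
    have hne : ybRatio θ * (weightV θ : ℂ) * tFiveEighths ^ 8 ≠ 0 := mul_ne_zero (mul_ne_zero hr hv) (pow_ne_zero _ ht)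
    apply mul_left_cancel₀ hne
    linear_combination tFiveEighths ^ 4 * slot + (-X) * e5 + (-(ybRatio θ * (weightV θ : ℂ) * X)) * h16

/-- ★★★ **The hole defect law on the whole printed range**: for every `θ ∈ [π/3, 2π/3]`, every finite face
list and every isthmus hole root, the defect of the Yang–Baxter vertex identity at the root plaquette is an
explicit monomial times ONE boundary-to-boundary observable of `D ∖ {w}` across the slot:
`VF_D(w.side σ, w) = 2 · v(θ) · c_{σ.opp} · t^{−4·qTurn σ ℓ} · G_{D∖w}(w.side ℓ → w.side ℓ.opp)`
(`ℓ = lat σ`; `c = (1, r(θ), −1, −r(θ))`, `v(θ) = weightV θ`, `t = e^{−5iπ/16}`).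
[cite: GlazmanManolescu2019, Lemma 2.1 (statement, "in the form given in [Gl]"); Glazman2015WeightedSAW, Lemma 3.1 (proof), eq. (1)] [cite: DuminilCopinSmirnov2012, proof of Lemma 1 («we used the fact that a is on the boundary and Ω is simply connected»)] -/
theorem vertexFunctional_printed_isthmus_root_eq_slot {θ : ℝ} (hθ : θ ∈ Set.Icc (π / 3) (2 * π / 3))
    (Dl : List Face) (w : Face) (σ : Side) (hw : w ∈ Dl) (hh : nbr w σ ∉ dom Dl)
    (hO : OuterRoot (dom Dl) (w.side σ.opp)) :
    vertexFunctional (printedWeights θ) tFiveEighths (ybCoeff θ) Dl (w.side σ) w =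
      2 * (weightV θ : ℂ) * ybCoeff θ (slotIdx σ.opp) * tFiveEighths ^ (-(4 : ℤ) * qTurn σ (lat σ)) *
        gmObservable (printedWeights θ) tFiveEighths (eraseFace Dl w) (w.side (lat σ)) (w.side (lat σ).opp) := by
  have h16 := tFiveEighths_pow_sixteen
  obtain ⟨e1, e2, e3, e4, e5, e6, e7, e8⟩ := defectCoeff_printed_values hθ
  have rev := gmObservable_slot_reverse_printed hθ Dl w σ hw hh hO
  have p2 := vertexFunctional_printed_isthmus_root hθ Dl w σ hw hh hO
  rw [sum_lat] at p2
  simp only [Side.opp_opp] at p2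
  cases σ
  · set X := gmObservable (printedWeights θ) tFiveEighths (eraseFace Dl w) (w.side Side.S) (w.side Side.N)
    set Y := gmObservable (printedWeights θ) tFiveEighths (eraseFace Dl w) (w.side Side.N) (w.side Side.S)
    change vertexFunctional (printedWeights θ) tFiveEighths (ybCoeff θ) Dl (w.side Side.W) w =
      defectCoeff (printedWeights θ) tFiveEighths (ybCoeff θ) .W .S * X +
        defectCoeff (printedWeights θ) tFiveEighths (ybCoeff θ) .W .N * Y at p2
    change Y = tFiveEighths ^ (-(8 : ℤ) * qTurn Side.W Side.S) * X at rev
    rw [show (-(8 : ℤ)) * qTurn Side.W Side.S = 8 from by decide, zt_eightP₃] at rev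
    change _ = 2 * (weightV θ : ℂ) * ybCoeff θ 0 * tFiveEighths ^ (-(4 : ℤ) * qTurn Side.W Side.S) * X
    rw [ybc0₃, show (-(4 : ℤ)) * qTurn Side.W Side.S = 4 from by decide, zt_fourP₃]
    rw [e1] at p2
    linear_combination p2 + defectCoeff (printedWeights θ) tFiveEighths (ybCoeff θ) .W .N * rev +
      (tFiveEighths ^ 4 * X) * e2
  · set X := gmObservable (printedWeights θ) tFiveEighths (eraseFace Dl w) (w.side Side.S) (w.side Side.N)
    set Y := gmObservable (printedWeights θ) tFiveEighths (eraseFace Dl w) (w.side Side.N) (w.side Side.S)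
    change vertexFunctional (printedWeights θ) tFiveEighths (ybCoeff θ) Dl (w.side Side.E) w =
      defectCoeff (printedWeights θ) tFiveEighths (ybCoeff θ) .E .S * X +
        defectCoeff (printedWeights θ) tFiveEighths (ybCoeff θ) .E .N * Y at p2
    change Y = tFiveEighths ^ (-(8 : ℤ) * qTurn Side.E Side.S) * X at rev
    rw [show (-(8 : ℤ)) * qTurn Side.E Side.S = -8 from by decide, zt_neg_eightP₃] at rev
    change _ = 2 * (weightV θ : ℂ) * ybCoeff θ 2 * tFiveEighths ^ (-(4 : ℤ) * qTurn Side.E Side.S) * X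
    rw [ybc2₃, show (-(4 : ℤ)) * qTurn Side.E Side.S = -4 from by decide, zt_neg_fourP₃]
    rw [e4] at p2
    linear_combination p2 + (-((weightV θ : ℂ) * tFiveEighths ^ 4)) * rev + (-(X * tFiveEighths ^ 12)) * e3 +
      (X * defectCoeff (printedWeights θ) tFiveEighths (ybCoeff θ) .E .S) * h16
  · set X := gmObservable (printedWeights θ) tFiveEighths (eraseFace Dl w) (w.side Side.W) (w.side Side.E)
    set Y := gmObservable (printedWeights θ) tFiveEighths (eraseFace Dl w) (w.side Side.E) (w.side Side.W)
    change vertexFunctional (printedWeights θ) tFiveEighths (ybCoeff θ) Dl (w.side Side.S) w =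
      defectCoeff (printedWeights θ) tFiveEighths (ybCoeff θ) .S .W * X +
        defectCoeff (printedWeights θ) tFiveEighths (ybCoeff θ) .S .E * Y at p2
    change Y = tFiveEighths ^ (-(8 : ℤ) * qTurn Side.S Side.W) * X at rev
    rw [show (-(8 : ℤ)) * qTurn Side.S Side.W = -8 from by decide, zt_neg_eightP₃] at rev
    change _ = 2 * (weightV θ : ℂ) * ybCoeff θ 1 * tFiveEighths ^ (-(4 : ℤ) * qTurn Side.S Side.W) * X
    rw [ybc1₃, show (-(4 : ℤ)) * qTurn Side.S Side.W = -4 from by decide, zt_neg_fourP₃]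
    rw [e6] at p2
    linear_combination p2 + (ybRatio θ * (weightV θ : ℂ) * tFiveEighths ^ 4) * rev +
      (X * defectCoeff (printedWeights θ) tFiveEighths (ybCoeff θ) .S .W) * h16 + (-(X * tFiveEighths ^ 12)) * e5
  · set X := gmObservable (printedWeights θ) tFiveEighths (eraseFace Dl w) (w.side Side.W) (w.side Side.E)
    set Y := gmObservable (printedWeights θ) tFiveEighths (eraseFace Dl w) (w.side Side.E) (w.side Side.W)
    change vertexFunctional (printedWeights θ) tFiveEighths (ybCoeff θ) Dl (w.side Side.N) w =
      defectCoeff (printedWeights θ) tFiveEighths (ybCoeff θ) .N .W * X +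
        defectCoeff (printedWeights θ) tFiveEighths (ybCoeff θ) .N .E * Y at p2
    change Y = tFiveEighths ^ (-(8 : ℤ) * qTurn Side.N Side.W) * X at rev
    rw [show (-(8 : ℤ)) * qTurn Side.N Side.W = 8 from by decide, zt_eightP₃] at rev
    change _ = 2 * (weightV θ : ℂ) * ybCoeff θ 3 * tFiveEighths ^ (-(4 : ℤ) * qTurn Side.N Side.W) * X
    rw [ybc3₃, show (-(4 : ℤ)) * qTurn Side.N Side.W = 4 from by decide, zt_fourP₃]
    rw [e7] at p2
    linear_combination p2 + defectCoeff (printedWeights θ) tFiveEighths (ybCoeff θ) .N .E * rev +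
      (tFiveEighths ^ 4 * X) * e8

/-- ★★★ **On the whole printed range, the Yang–Baxter vertex identity at the root plaquette of an isthmus
hole root holds iff the slot observable vanishes.** [cite: DuminilCopinSmirnov2012, proof of Lemma 1] [cite: GlazmanManolescu2019, Lemma 2.1] -/
theorem vertexFunctional_printed_isthmus_root_eq_zero_iff_slot {θ : ℝ} (hθ : θ ∈ Set.Icc (π / 3) (2 * π / 3))
    (Dl : List Face) (w : Face) (σ : Side) (hw : w ∈ Dl) (hh : nbr w σ ∉ dom Dl)
    (hO : OuterRoot (dom Dl) (w.side σ.opp)) :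
    vertexFunctional (printedWeights θ) tFiveEighths (ybCoeff θ) Dl (w.side σ) w = 0 ↔
      gmObservable (printedWeights θ) tFiveEighths (eraseFace Dl w) (w.side (lat σ)) (w.side (lat σ).opp) = 0 := by
  rw [vertexFunctional_printed_isthmus_root_eq_slot hθ Dl w σ hw hh hO]
  have hv : (weightV θ : ℂ) ≠ 0 := Complex.ofReal_ne_zero.2 (weightV_ne_zero_of_mem hθ)
  have hc : ybCoeff θ (slotIdx σ.opp) ≠ 0 := by
    cases σ
    · exact one_ne_zero
    · change (-1 : ℂ) ≠ 0; norm_num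
    · exact ybRatio_ne_zero θ
    · exact neg_ne_zero.2 (ybRatio_ne_zero θ)
  have ht : tFiveEighths ^ (-(4 : ℤ) * qTurn σ (lat σ)) ≠ 0 := zpow_ne_zero _ tFiveEighths_ne_zero
  have h2 : (2 : ℂ) ≠ 0 := two_ne_zero
  constructor
  · intro h
    rcases mul_eq_zero.1 h with h' | h'
    · exact absurd h' (mul_ne_zero (mul_ne_zero (mul_ne_zero h2 hv) hc) ht)
    · exact h'
  · intro h
    rw [h, mul_zero]

/-- `‖c_{σ.opp}‖ = 1` (`|r(θ)| = 1`). [cite: GlazmanManolescu2019, Lemma 2.1, eq. (CR)] -/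
private theorem norm_ybCoeff_slotIdx₃ (θ : ℝ) (σ : Side) : ‖ybCoeff θ (slotIdx σ.opp)‖ = 1 := by
  have hr : ‖ybRatio θ‖ = 1 := by
    rw [ybRatio]; exact Complex.norm_exp_ofReal_mul_I _
  cases σ
  · exact norm_one
  · change ‖(-1 : ℂ)‖ = 1; simp
  · exact hr
  · change ‖-ybRatio θ‖ = 1; rw [norm_neg, hr]

/-- `‖t‖ = 1`. [folklore] -/
private theorem norm_tFiveEighths₃ : ‖tFiveEighths‖ = 1 := by
  rw [tFiveEighths, show -(5 * (π : ℂ) / 16 * Complex.I) = ((-(5 * π / 16) : ℝ) : ℂ) * Complex.I by push_cast; ring]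
  exact Complex.norm_exp_ofReal_mul_I _

/-- ★★★ **The modulus law of the hole defect on the whole printed range**: for every `θ ∈ [π/3, 2π/3]`,
every finite face list and every isthmus hole root,
`‖VF_D(w.side σ, w)‖ = 2·v(θ)·‖G_{D∖w}(w.side ℓ → w.side ℓ.opp)‖` with `v(θ) = weightV θ > 0`
(`2v(π/3) = 2x_c² = 2 − √2`: Part 3b; `2v(π/2) ≈ 0.6417`). [cite: GlazmanManolescu2019, eq. (1), Lemma 2.1 (statement, "in the form given in [Gl]"); Glazman2015WeightedSAW, Lemma 3.1 (proof)] [cite: DuminilCopinSmirnov2012, proof of Lemma 1] -/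
theorem norm_vertexFunctional_printed_isthmus_root {θ : ℝ} (hθ : θ ∈ Set.Icc (π / 3) (2 * π / 3))
    (Dl : List Face) (w : Face) (σ : Side) (hw : w ∈ Dl) (hh : nbr w σ ∉ dom Dl)
    (hO : OuterRoot (dom Dl) (w.side σ.opp)) :
    ‖vertexFunctional (printedWeights θ) tFiveEighths (ybCoeff θ) Dl (w.side σ) w‖ =
      2 * |weightV θ| *
        ‖gmObservable (printedWeights θ) tFiveEighths (eraseFace Dl w) (w.side (lat σ)) (w.side (lat σ).opp)‖ := by
  rw [vertexFunctional_printed_isthmus_root_eq_slot hθ Dl w σ hw hh hO, norm_mul, norm_mul, norm_mul, norm_mul,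
    norm_zpow, norm_tFiveEighths₃, one_zpow, mul_one, norm_ybCoeff_slotIdx₃, mul_one, Complex.norm_real,
    Real.norm_eq_abs]
  norm_num

end PrintedRange

end Literature.Barriers.CriticalPhenomena.PlaquetteWalk

/-! ## Part 3d — the same laws on the complexified Yang–Baxter curve at the printed spin

For `W = ybCurve (−1) t r`, `t = e^{−5iπ/16}`, `c = (1, r, −1, −r)`, at EVERY `r ∈ ℂ` with `r ≠ 0` off the
zero set of the curve's denominator (the setting of the tree's F4 `vertexFunctional_ybCurve_eq_zero`), and
every isthmus hole root of every finite face list: the slot relation, the slot reversal law (for `v ≠ 0`)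
and the hole defect law `VF_D(w.side σ, w) = 2·v·c_{σ.opp}·t^{−4q}·X` (unconditionally in `v`), with
`v = ybV (−1) t r`; hence `‖VF‖ = 2‖v‖·‖c_{σ.opp}‖·‖X‖` (`‖c_{σ.opp}‖ = 1` for `σ ∈ {W, E}`, `= ‖r‖` for
`σ ∈ {S, N}`). The printed family is the arc `r = r(θ)`.
-/

namespace Literature.Barriers.CriticalPhenomena.PlaquetteWalk

open Literature.Probability.RandomPlanarGeometry.SAW.YangBaxter
open Literature.Probability.RandomPlanarGeometry.SAW.YangBaxter.MidEdge
open Literature.Probability.RandomPlanarGeometry.SAW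

section ComplexCurve

variable {r : ℂ}

/-- ★ **The slot relation on the curve** (`t = e^{−5iπ/16}`, any good `r`). [cite: GlazmanManolescu2019, Lemma 2.1, eq. (2.2) (CR)] -/
theorem slot_relation_ybCurve (hr : r ≠ 0)
    (hD : tFiveEighths ^ 6 * (1 + r ^ 4) - (1 + tFiveEighths ^ 12) * r ^ 2 ≠ 0) (Dl : List Face) (w : Face)
    (σ : Side) (hw : w ∈ Dl) (hh : nbr w σ ∉ dom Dl) (hO : OuterRoot (dom Dl) (w.side σ.opp)) :
    defectCoeff (ybCurve (-1) tFiveEighths r) tFiveEighths (oddCoeff r) σ.opp (lat σ) *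
        gmObservable (ybCurve (-1) tFiveEighths r) tFiveEighths (eraseFace Dl w) (w.side (lat σ)) (w.side (lat σ).opp) +
      defectCoeff (ybCurve (-1) tFiveEighths r) tFiveEighths (oddCoeff r) σ.opp (lat σ).opp *
        gmObservable (ybCurve (-1) tFiveEighths r) tFiveEighths (eraseFace Dl w) (w.side (lat σ).opp) (w.side (lat σ)) = 0 := by
  have h := vertexFunctional_isthmus_root_opp (ybCurve (-1) tFiveEighths r) tFiveEighths_ne_zero (oddCoeff r) hw hh
    (nbr_opp_not_mem hw hO)
  rw [vertexFunctional_ybCurve_eq_zero hr hD Dl (w.side σ.opp) hO w hw,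
    vertexFunctional_ybCurve_eq_zero hr hD [w] (w.side σ.opp) (outerRoot_single w σ.opp) w
      (List.mem_singleton.2 rfl), zero_add, sum_lat] at h
  simpa only [Side.opp_opp] using h.symm

/-- ★★ **The slot reversal law on the curve** (`v ≠ 0`): `Y = t^{−8q} · X`, `q = qTurn σ (lat σ)`.
[cite: GlazmanManolescu2019, Lemma 2.1 (statement, "in the form given in [Gl]"); Glazman2015WeightedSAW, Lemma 3.1 (proof)] [cite: DuminilCopinSmirnov2012, proof of Lemma 1] -/
theorem gmObservable_slot_reverse_ybCurve (hr : r ≠ 0)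
    (hD : tFiveEighths ^ 6 * (1 + r ^ 4) - (1 + tFiveEighths ^ 12) * r ^ 2 ≠ 0)
    (hv : ybV (-1) tFiveEighths r ≠ 0) (Dl : List Face) (w : Face) (σ : Side) (hw : w ∈ Dl)
    (hh : nbr w σ ∉ dom Dl) (hO : OuterRoot (dom Dl) (w.side σ.opp)) :
    gmObservable (ybCurve (-1) tFiveEighths r) tFiveEighths (eraseFace Dl w) (w.side (lat σ).opp) (w.side (lat σ)) =
      tFiveEighths ^ (-(8 : ℤ) * qTurn σ (lat σ)) *
        gmObservable (ybCurve (-1) tFiveEighths r) tFiveEighths (eraseFace Dl w) (w.side (lat σ)) (w.side (lat σ).opp) := by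
  have h16 := tFiveEighths_pow_sixteen
  have ht : tFiveEighths ≠ 0 := tFiveEighths_ne_zero
  obtain ⟨e1, e2, e3, e4, e5, e6, e7, e8⟩ :=
    defectCoeff_ybCurve_values (r := r) ht tFiveEighths_pow_four_ne_one₃ hr hD
  have slot0 := slot_relation_ybCurve hr hD Dl w σ hw hh hO
  cases σ
  · set X := gmObservable (ybCurve (-1) tFiveEighths r) tFiveEighths (eraseFace Dl w) (w.side Side.S) (w.side Side.N)
    set Y := gmObservable (ybCurve (-1) tFiveEighths r) tFiveEighths (eraseFace Dl w) (w.side Side.N) (w.side Side.S)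
    have slot : defectCoeff (ybCurve (-1) tFiveEighths r) tFiveEighths (oddCoeff r) .E .S * X +
        defectCoeff (ybCurve (-1) tFiveEighths r) tFiveEighths (oddCoeff r) .E .N * Y = 0 := slot0
    rw [e4] at slot
    change Y = tFiveEighths ^ (-(8 : ℤ) * qTurn Side.W Side.S) * X
    rw [show (-(8 : ℤ)) * qTurn Side.W Side.S = 8 from by decide, zt_eightP₃]
    have hne : ybV (-1) tFiveEighths r * tFiveEighths ^ 8 ≠ 0 := mul_ne_zero hv (pow_ne_zero _ ht)
    apply mul_left_cancel₀ hne
    linear_combination (-tFiveEighths ^ 4) * slot + X * e3 + (-(ybV (-1) tFiveEighths r * X)) * h16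
  · set X := gmObservable (ybCurve (-1) tFiveEighths r) tFiveEighths (eraseFace Dl w) (w.side Side.S) (w.side Side.N)
    set Y := gmObservable (ybCurve (-1) tFiveEighths r) tFiveEighths (eraseFace Dl w) (w.side Side.N) (w.side Side.S)
    have slot : defectCoeff (ybCurve (-1) tFiveEighths r) tFiveEighths (oddCoeff r) .W .S * X +
        defectCoeff (ybCurve (-1) tFiveEighths r) tFiveEighths (oddCoeff r) .W .N * Y = 0 := slot0
    rw [e1] at slot
    change Y = tFiveEighths ^ (-(8 : ℤ) * qTurn Side.E Side.S) * X
    rw [show (-(8 : ℤ)) * qTurn Side.E Side.S = -8 from by decide, zt_neg_eightP₃]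
    apply mul_left_cancel₀ hv
    linear_combination tFiveEighths ^ 4 * slot + (-Y) * e2
  · set X := gmObservable (ybCurve (-1) tFiveEighths r) tFiveEighths (eraseFace Dl w) (w.side Side.W) (w.side Side.E)
    set Y := gmObservable (ybCurve (-1) tFiveEighths r) tFiveEighths (eraseFace Dl w) (w.side Side.E) (w.side Side.W)
    have slot : defectCoeff (ybCurve (-1) tFiveEighths r) tFiveEighths (oddCoeff r) .N .W * X +
        defectCoeff (ybCurve (-1) tFiveEighths r) tFiveEighths (oddCoeff r) .N .E * Y = 0 := slot0
    rw [e7] at slot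
    change Y = tFiveEighths ^ (-(8 : ℤ) * qTurn Side.S Side.W) * X
    rw [show (-(8 : ℤ)) * qTurn Side.S Side.W = -8 from by decide, zt_neg_eightP₃]
    have hne : r * ybV (-1) tFiveEighths r ≠ 0 := mul_ne_zero hr hv
    apply mul_left_cancel₀ hne
    linear_combination (-tFiveEighths ^ 4) * slot + Y * e8
  · set X := gmObservable (ybCurve (-1) tFiveEighths r) tFiveEighths (eraseFace Dl w) (w.side Side.W) (w.side Side.E)
    set Y := gmObservable (ybCurve (-1) tFiveEighths r) tFiveEighths (eraseFace Dl w) (w.side Side.E) (w.side Side.W)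
    have slot : defectCoeff (ybCurve (-1) tFiveEighths r) tFiveEighths (oddCoeff r) .S .W * X +
        defectCoeff (ybCurve (-1) tFiveEighths r) tFiveEighths (oddCoeff r) .S .E * Y = 0 := slot0
    rw [e6] at slot
    change Y = tFiveEighths ^ (-(8 : ℤ) * qTurn Side.N Side.W) * X
    rw [show (-(8 : ℤ)) * qTurn Side.N Side.W = 8 from by decide, zt_eightP₃]
    have hne : r * ybV (-1) tFiveEighths r * tFiveEighths ^ 8 ≠ 0 := mul_ne_zero (mul_ne_zero hr hv) (pow_ne_zero _ ht)
    apply mul_left_cancel₀ hne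
    linear_combination tFiveEighths ^ 4 * slot + (-X) * e5 + (-(r * ybV (-1) tFiveEighths r * X)) * h16

/-- Part 2 at the hole root on the curve, two-term form: `VF_D(w.side σ, w) = dc(σ,ℓ)·X + dc(σ,ℓ.opp)·Y` (the
one-plaquette functional vanishes by F4 on `[w]`). [cite: GlazmanManolescu2019, Lemma 2.1 (statement, "in the form given in [Gl]"); Glazman2015WeightedSAW, Lemma 3.1 (proof)] -/
theorem vertexFunctional_ybCurve_isthmus_root (hr : r ≠ 0)
    (hD : tFiveEighths ^ 6 * (1 + r ^ 4) - (1 + tFiveEighths ^ 12) * r ^ 2 ≠ 0) (Dl : List Face) (w : Face)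
    (σ : Side) (hw : w ∈ Dl) (hh : nbr w σ ∉ dom Dl) (hO : OuterRoot (dom Dl) (w.side σ.opp)) :
    vertexFunctional (ybCurve (-1) tFiveEighths r) tFiveEighths (oddCoeff r) Dl (w.side σ) w =
      defectCoeff (ybCurve (-1) tFiveEighths r) tFiveEighths (oddCoeff r) σ (lat σ) *
          gmObservable (ybCurve (-1) tFiveEighths r) tFiveEighths (eraseFace Dl w) (w.side (lat σ)) (w.side (lat σ).opp) +
        defectCoeff (ybCurve (-1) tFiveEighths r) tFiveEighths (oddCoeff r) σ (lat σ).opp *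
          gmObservable (ybCurve (-1) tFiveEighths r) tFiveEighths (eraseFace Dl w) (w.side (lat σ).opp) (w.side (lat σ)) := by
  rw [vertexFunctional_isthmus_root _ tFiveEighths_ne_zero _ hw hh (nbr_opp_not_mem hw hO),
    vertexFunctional_ybCurve_eq_zero hr hD [w] (w.side σ) (outerRoot_single w σ) w (List.mem_singleton.2 rfl),
    zero_add, sum_lat]
  simp only [Side.opp_opp]

/-- ★★★ **The hole defect law on the curve** (`t = e^{−5iπ/16}`, any good `r`; unconditional in `v`):
`VF_D(w.side σ, w) = 2 · v · c_{σ.opp} · t^{−4·qTurn σ ℓ} · X`, `v = ybV (−1) t r`.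
[cite: GlazmanManolescu2019, Lemma 2.1 (statement, "in the form given in [Gl]"); Glazman2015WeightedSAW, Lemma 3.1 (proof), eq. (1)] [cite: DuminilCopinSmirnov2012, proof of Lemma 1] -/
theorem vertexFunctional_ybCurve_isthmus_root_eq_slot (hr : r ≠ 0)
    (hD : tFiveEighths ^ 6 * (1 + r ^ 4) - (1 + tFiveEighths ^ 12) * r ^ 2 ≠ 0) (Dl : List Face) (w : Face)
    (σ : Side) (hw : w ∈ Dl) (hh : nbr w σ ∉ dom Dl) (hO : OuterRoot (dom Dl) (w.side σ.opp)) :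
    vertexFunctional (ybCurve (-1) tFiveEighths r) tFiveEighths (oddCoeff r) Dl (w.side σ) w =
      2 * ybV (-1) tFiveEighths r * oddCoeff r (slotIdx σ.opp) * tFiveEighths ^ (-(4 : ℤ) * qTurn σ (lat σ)) *
        gmObservable (ybCurve (-1) tFiveEighths r) tFiveEighths (eraseFace Dl w) (w.side (lat σ)) (w.side (lat σ).opp) := by
  have h16 := tFiveEighths_pow_sixteen
  have ht : tFiveEighths ≠ 0 := tFiveEighths_ne_zero
  obtain ⟨e1, e2, e3, e4, e5, e6, e7, e8⟩ :=
    defectCoeff_ybCurve_values (r := r) ht tFiveEighths_pow_four_ne_one₃ hr hD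
  have p2 := vertexFunctional_ybCurve_isthmus_root hr hD Dl w σ hw hh hO
  by_cases hv : ybV (-1) tFiveEighths r = 0
  · -- degenerate curve points: every defect coefficient vanishes with `v`
    have ht4 : tFiveEighths ^ 4 ≠ 0 := pow_ne_zero _ ht
    rw [hv] at e1 e2 e3 e4 e5 e6 e7 e8
    rw [p2, hv]
    cases σ
    · change defectCoeff (ybCurve (-1) tFiveEighths r) tFiveEighths (oddCoeff r) .W .S * _ +
        defectCoeff (ybCurve (-1) tFiveEighths r) tFiveEighths (oddCoeff r) .W .N * _ = _
      rw [e1, (mul_eq_zero.1 e2).resolve_right ht4]; ring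
    · change defectCoeff (ybCurve (-1) tFiveEighths r) tFiveEighths (oddCoeff r) .E .S * _ +
        defectCoeff (ybCurve (-1) tFiveEighths r) tFiveEighths (oddCoeff r) .E .N * _ = _
      rw [e4, show defectCoeff (ybCurve (-1) tFiveEighths r) tFiveEighths (oddCoeff r) .E .S = 0 from
        (mul_eq_zero.1 (e3.trans (by ring))).resolve_right ht4]; ring
    · change defectCoeff (ybCurve (-1) tFiveEighths r) tFiveEighths (oddCoeff r) .S .W * _ +
        defectCoeff (ybCurve (-1) tFiveEighths r) tFiveEighths (oddCoeff r) .S .E * _ = _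
      rw [e6, show defectCoeff (ybCurve (-1) tFiveEighths r) tFiveEighths (oddCoeff r) .S .W = 0 from
        (mul_eq_zero.1 (e5.trans (by ring))).resolve_right ht4]; ring
    · change defectCoeff (ybCurve (-1) tFiveEighths r) tFiveEighths (oddCoeff r) .N .W * _ +
        defectCoeff (ybCurve (-1) tFiveEighths r) tFiveEighths (oddCoeff r) .N .E * _ = _
      rw [e7, show defectCoeff (ybCurve (-1) tFiveEighths r) tFiveEighths (oddCoeff r) .N .E = 0 from
        (mul_eq_zero.1 (e8.trans (by ring))).resolve_right ht4]; ring
  · have rev := gmObservable_slot_reverse_ybCurve hr hD hv Dl w σ hw hh hO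
    cases σ
    · set X := gmObservable (ybCurve (-1) tFiveEighths r) tFiveEighths (eraseFace Dl w) (w.side Side.S) (w.side Side.N)
      set Y := gmObservable (ybCurve (-1) tFiveEighths r) tFiveEighths (eraseFace Dl w) (w.side Side.N) (w.side Side.S)
      change vertexFunctional (ybCurve (-1) tFiveEighths r) tFiveEighths (oddCoeff r) Dl (w.side Side.W) w =
        defectCoeff (ybCurve (-1) tFiveEighths r) tFiveEighths (oddCoeff r) .W .S * X +
          defectCoeff (ybCurve (-1) tFiveEighths r) tFiveEighths (oddCoeff r) .W .N * Y at p2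
      change Y = tFiveEighths ^ (-(8 : ℤ) * qTurn Side.W Side.S) * X at rev
      rw [show (-(8 : ℤ)) * qTurn Side.W Side.S = 8 from by decide, zt_eightP₃] at rev
      change _ = 2 * ybV (-1) tFiveEighths r * oddCoeff r 0 * tFiveEighths ^ (-(4 : ℤ) * qTurn Side.W Side.S) * X
      rw [oc0₃, show (-(4 : ℤ)) * qTurn Side.W Side.S = 4 from by decide, zt_fourP₃]
      rw [e1] at p2
      linear_combination p2 + defectCoeff (ybCurve (-1) tFiveEighths r) tFiveEighths (oddCoeff r) .W .N * rev +
        (tFiveEighths ^ 4 * X) * e2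
    · set X := gmObservable (ybCurve (-1) tFiveEighths r) tFiveEighths (eraseFace Dl w) (w.side Side.S) (w.side Side.N)
      set Y := gmObservable (ybCurve (-1) tFiveEighths r) tFiveEighths (eraseFace Dl w) (w.side Side.N) (w.side Side.S)
      change vertexFunctional (ybCurve (-1) tFiveEighths r) tFiveEighths (oddCoeff r) Dl (w.side Side.E) w =
        defectCoeff (ybCurve (-1) tFiveEighths r) tFiveEighths (oddCoeff r) .E .S * X +
          defectCoeff (ybCurve (-1) tFiveEighths r) tFiveEighths (oddCoeff r) .E .N * Y at p2
      change Y = tFiveEighths ^ (-(8 : ℤ) * qTurn Side.E Side.S) * X at rev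
      rw [show (-(8 : ℤ)) * qTurn Side.E Side.S = -8 from by decide, zt_neg_eightP₃] at rev
      change _ = 2 * ybV (-1) tFiveEighths r * oddCoeff r 2 * tFiveEighths ^ (-(4 : ℤ) * qTurn Side.E Side.S) * X
      rw [oc2₃, show (-(4 : ℤ)) * qTurn Side.E Side.S = -4 from by decide, zt_neg_fourP₃]
      rw [e4] at p2
      linear_combination p2 + (-(ybV (-1) tFiveEighths r * tFiveEighths ^ 4)) * rev + (-(X * tFiveEighths ^ 12)) * e3 +
        (X * defectCoeff (ybCurve (-1) tFiveEighths r) tFiveEighths (oddCoeff r) .E .S) * h16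
    · set X := gmObservable (ybCurve (-1) tFiveEighths r) tFiveEighths (eraseFace Dl w) (w.side Side.W) (w.side Side.E)
      set Y := gmObservable (ybCurve (-1) tFiveEighths r) tFiveEighths (eraseFace Dl w) (w.side Side.E) (w.side Side.W)
      change vertexFunctional (ybCurve (-1) tFiveEighths r) tFiveEighths (oddCoeff r) Dl (w.side Side.S) w =
        defectCoeff (ybCurve (-1) tFiveEighths r) tFiveEighths (oddCoeff r) .S .W * X +
          defectCoeff (ybCurve (-1) tFiveEighths r) tFiveEighths (oddCoeff r) .S .E * Y at p2
      change Y = tFiveEighths ^ (-(8 : ℤ) * qTurn Side.S Side.W) * X at rev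
      rw [show (-(8 : ℤ)) * qTurn Side.S Side.W = -8 from by decide, zt_neg_eightP₃] at rev
      change _ = 2 * ybV (-1) tFiveEighths r * oddCoeff r 1 * tFiveEighths ^ (-(4 : ℤ) * qTurn Side.S Side.W) * X
      rw [oc1₃, show (-(4 : ℤ)) * qTurn Side.S Side.W = -4 from by decide, zt_neg_fourP₃]
      rw [e6] at p2
      linear_combination p2 + (r * ybV (-1) tFiveEighths r * tFiveEighths ^ 4) * rev +
        (X * defectCoeff (ybCurve (-1) tFiveEighths r) tFiveEighths (oddCoeff r) .S .W) * h16 + (-(X * tFiveEighths ^ 12)) * e5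
    · set X := gmObservable (ybCurve (-1) tFiveEighths r) tFiveEighths (eraseFace Dl w) (w.side Side.W) (w.side Side.E)
      set Y := gmObservable (ybCurve (-1) tFiveEighths r) tFiveEighths (eraseFace Dl w) (w.side Side.E) (w.side Side.W)
      change vertexFunctional (ybCurve (-1) tFiveEighths r) tFiveEighths (oddCoeff r) Dl (w.side Side.N) w =
        defectCoeff (ybCurve (-1) tFiveEighths r) tFiveEighths (oddCoeff r) .N .W * X +
          defectCoeff (ybCurve (-1) tFiveEighths r) tFiveEighths (oddCoeff r) .N .E * Y at p2
      change Y = tFiveEighths ^ (-(8 : ℤ) * qTurn Side.N Side.W) * X at rev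
      rw [show (-(8 : ℤ)) * qTurn Side.N Side.W = 8 from by decide, zt_eightP₃] at rev
      change _ = 2 * ybV (-1) tFiveEighths r * oddCoeff r 3 * tFiveEighths ^ (-(4 : ℤ) * qTurn Side.N Side.W) * X
      rw [oc3₃, show (-(4 : ℤ)) * qTurn Side.N Side.W = 4 from by decide, zt_fourP₃]
      rw [e7] at p2
      linear_combination p2 + defectCoeff (ybCurve (-1) tFiveEighths r) tFiveEighths (oddCoeff r) .N .E * rev +
        (tFiveEighths ^ 4 * X) * e8

/-- ★★★ **The modulus law on the curve**: `‖VF_D(w.side σ, w)‖ = 2·‖v‖·‖c_{σ.opp}‖·‖X‖` (`‖c_{σ.opp}‖ = 1` for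
`σ ∈ {W, E}`, `‖r‖` for `σ ∈ {S, N}`). [cite: GlazmanManolescu2019, Lemma 2.1 (statement, "in the form given in [Gl]"); Glazman2015WeightedSAW, Lemma 3.1 (proof), eq. (1)] [cite: DuminilCopinSmirnov2012, proof of Lemma 1] -/
theorem norm_vertexFunctional_ybCurve_isthmus_root (hr : r ≠ 0)
    (hD : tFiveEighths ^ 6 * (1 + r ^ 4) - (1 + tFiveEighths ^ 12) * r ^ 2 ≠ 0) (Dl : List Face) (w : Face)
    (σ : Side) (hw : w ∈ Dl) (hh : nbr w σ ∉ dom Dl) (hO : OuterRoot (dom Dl) (w.side σ.opp)) :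
    ‖vertexFunctional (ybCurve (-1) tFiveEighths r) tFiveEighths (oddCoeff r) Dl (w.side σ) w‖ =
      2 * ‖ybV (-1) tFiveEighths r‖ * ‖oddCoeff r (slotIdx σ.opp)‖ *
        ‖gmObservable (ybCurve (-1) tFiveEighths r) tFiveEighths (eraseFace Dl w) (w.side (lat σ)) (w.side (lat σ).opp)‖ := by
  rw [vertexFunctional_ybCurve_isthmus_root_eq_slot hr hD Dl w σ hw hh hO, norm_mul, norm_mul, norm_mul, norm_mul,
    norm_zpow, norm_tFiveEighths₃, one_zpow, mul_one]
  norm_num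

end ComplexCurve

end Literature.Barriers.CriticalPhenomena.PlaquetteWalk

/-! ## Part 3e — the same laws at EVERY admissible spin, modulo the curve identity at that spin (F8's theorem)

For `W = ybCurve (−1) t r` at ANY spin `t` with `t¹⁶ = −1` (the sixteen Galois-conjugate curves of the tree's F8
`PlaquetteWalkYBCurveIdentityAllSpins`), `c = (1, r, −1, −r)`, `r ≠ 0` off the denominator's zeros, ASSUMING the
curve identity at that spin for outer roots (`hId`; = F8's `vertexFunctional_ybCurve_eq_zero_of_pow_sixteen h16 hr hD`,
not imported here; at `t = e^{−5iπ/16}` it is the tree's F4 and Part 3d is recovered): slot relation, slot reversal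
law (`v ≠ 0`), hole defect law `VF_D(w.side σ, w) = 2·v·c_{σ.opp}·t^{−4q}·X` (unconditional in `v`), modulus law
`‖VF‖ = 2‖v‖‖c_{σ.opp}‖‖t‖^{−4q}‖X‖`-free form `‖VF‖ = 2‖v‖‖c_{σ.opp}‖‖X‖` when `‖t‖ = 1`. Only `t¹⁶ = −1` is used
(`t⁻⁸ = −t⁸`, `t⁻⁴ = −t¹²`).
-/

namespace Literature.Barriers.CriticalPhenomena.PlaquetteWalk

open Literature.Probability.RandomPlanarGeometry.SAW.YangBaxter
open Literature.Probability.RandomPlanarGeometry.SAW.YangBaxter.MidEdge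
open Literature.Probability.RandomPlanarGeometry.SAW

section AllSpins

variable {t r : ℂ}

/-- The curve identity at spin `t` for the weights `ybCurve (−1) t r`, coefficients `(1, r, −1, −r)`, at every
outer root of every finite face list (F8's theorem at an admissible spin; F4 at `t = e^{−5iπ/16}`).
[cite: Glazman2015WeightedSAW, Lemma 3.1 (the σ = ℓ/8 families)] [cite: GlazmanManolescu2019, Lemma 2.1] -/
def CurveIdentityAt (t r : ℂ) : Prop :=
  ∀ (L : List Face) (a : MidEdge), OuterRoot (dom L) a → ∀ f₀ ∈ L,
    vertexFunctional (ybCurve (-1) t r) t (oddCoeff r) L a f₀ = 0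

/-- At the printed spin the curve identity is the tree's F4. [cite: GlazmanManolescu2019, Lemma 2.1] -/
theorem curveIdentityAt_tFiveEighths (hr : r ≠ 0)
    (hD : tFiveEighths ^ 6 * (1 + r ^ 4) - (1 + tFiveEighths ^ 12) * r ^ 2 ≠ 0) : CurveIdentityAt tFiveEighths r :=
  fun L a hO f₀ hf => vertexFunctional_ybCurve_eq_zero hr hD L a hO f₀ hf

/-- `t⁸` as an integer power. [folklore] -/
private theorem zs_eight₃ (t : ℂ) : t ^ (8 : ℤ) = t ^ 8 := by
  rw [show (8 : ℤ) = ((8 : ℕ) : ℤ) from rfl, zpow_natCast]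

/-- `t⁻⁸ = −t⁸` at an admissible spin. [folklore] -/
private theorem zs_neg_eight₃ (h16 : t ^ 16 = -1) : t ^ (-8 : ℤ) = -t ^ 8 := by
  rw [show (-8 : ℤ) = -((8 : ℕ) : ℤ) from rfl, zpow_neg, zpow_natCast]
  exact inv_eq_of_mul_eq_one_right (by linear_combination (-1 : ℂ) * h16)

/-- `t⁴` as an integer power. [folklore] -/
private theorem zs_four₃ (t : ℂ) : t ^ (4 : ℤ) = t ^ 4 := by
  rw [show (4 : ℤ) = ((4 : ℕ) : ℤ) from rfl, zpow_natCast]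

/-- `t⁻⁴ = −t¹²` at an admissible spin. [folklore] -/
private theorem zs_neg_four₃ (h16 : t ^ 16 = -1) : t ^ (-4 : ℤ) = -t ^ 12 := by
  rw [show (-4 : ℤ) = -((4 : ℕ) : ℤ) from rfl, zpow_neg, zpow_natCast]
  exact inv_eq_of_mul_eq_one_right (by linear_combination (-1 : ℂ) * h16)

/-- `t ≠ 0` at an admissible spin. [folklore] -/
private theorem spin_ne_zero₃ (h16 : t ^ 16 = -1) : t ≠ 0 := by
  rintro rfl; norm_num at h16

/-- `t⁴ ≠ 1` at an admissible spin. [folklore] -/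
private theorem spin_pow_four_ne_one₃ (h16 : t ^ 16 = -1) : t ^ 4 ≠ 1 := by
  intro h
  rw [show (16 : ℕ) = 4 * 4 from rfl, pow_mul, h, one_pow] at h16
  norm_num at h16

/-- ★ **The slot relation on the curve** (`t = e^{−5iπ/16}`, any good `r`). [cite: GlazmanManolescu2019, Lemma 2.1, eq. (2.2) (CR)] -/
theorem slot_relation_spin (h16 : t ^ 16 = -1) (hId : CurveIdentityAt t r) (Dl : List Face) (w : Face)
    (σ : Side) (hw : w ∈ Dl) (hh : nbr w σ ∉ dom Dl) (hO : OuterRoot (dom Dl) (w.side σ.opp)) :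
    defectCoeff (ybCurve (-1) t r) t (oddCoeff r) σ.opp (lat σ) *
        gmObservable (ybCurve (-1) t r) t (eraseFace Dl w) (w.side (lat σ)) (w.side (lat σ).opp) +
      defectCoeff (ybCurve (-1) t r) t (oddCoeff r) σ.opp (lat σ).opp *
        gmObservable (ybCurve (-1) t r) t (eraseFace Dl w) (w.side (lat σ).opp) (w.side (lat σ)) = 0 := by
  have h := vertexFunctional_isthmus_root_opp (ybCurve (-1) t r) (spin_ne_zero₃ h16) (oddCoeff r) hw hh
    (nbr_opp_not_mem hw hO)
  rw [hId Dl (w.side σ.opp) hO w hw,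
    hId [w] (w.side σ.opp) (outerRoot_single w σ.opp) w (List.mem_singleton.2 rfl), zero_add, sum_lat] at h
  simpa only [Side.opp_opp] using h.symm

/-- ★★ **The slot reversal law on the curve** (`v ≠ 0`): `Y = t^{−8q} · X`, `q = qTurn σ (lat σ)`.
[cite: GlazmanManolescu2019, Lemma 2.1 (statement, "in the form given in [Gl]"); Glazman2015WeightedSAW, Lemma 3.1 (proof)] [cite: DuminilCopinSmirnov2012, proof of Lemma 1] -/
theorem gmObservable_slot_reverse_spin (h16 : t ^ 16 = -1) (hr : r ≠ 0)
    (hD : t ^ 6 * (1 + r ^ 4) - (1 + t ^ 12) * r ^ 2 ≠ 0) (hId : CurveIdentityAt t r)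
    (hv : ybV (-1) t r ≠ 0) (Dl : List Face) (w : Face) (σ : Side) (hw : w ∈ Dl)
    (hh : nbr w σ ∉ dom Dl) (hO : OuterRoot (dom Dl) (w.side σ.opp)) :
    gmObservable (ybCurve (-1) t r) t (eraseFace Dl w) (w.side (lat σ).opp) (w.side (lat σ)) =
      t ^ (-(8 : ℤ) * qTurn σ (lat σ)) *
        gmObservable (ybCurve (-1) t r) t (eraseFace Dl w) (w.side (lat σ)) (w.side (lat σ).opp) := by
  have ht : t ≠ 0 := spin_ne_zero₃ h16
  obtain ⟨e1, e2, e3, e4, e5, e6, e7, e8⟩ :=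
    defectCoeff_ybCurve_values (r := r) ht (spin_pow_four_ne_one₃ h16) hr hD
  have slot0 := slot_relation_spin h16 hId Dl w σ hw hh hO
  cases σ
  · set X := gmObservable (ybCurve (-1) t r) t (eraseFace Dl w) (w.side Side.S) (w.side Side.N)
    set Y := gmObservable (ybCurve (-1) t r) t (eraseFace Dl w) (w.side Side.N) (w.side Side.S)
    have slot : defectCoeff (ybCurve (-1) t r) t (oddCoeff r) .E .S * X +
        defectCoeff (ybCurve (-1) t r) t (oddCoeff r) .E .N * Y = 0 := slot0
    rw [e4] at slot
    change Y = t ^ (-(8 : ℤ) * qTurn Side.W Side.S) * X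
    rw [show (-(8 : ℤ)) * qTurn Side.W Side.S = 8 from by decide, zs_eight₃]
    have hne : ybV (-1) t r * t ^ 8 ≠ 0 := mul_ne_zero hv (pow_ne_zero _ ht)
    apply mul_left_cancel₀ hne
    linear_combination (-t ^ 4) * slot + X * e3 + (-(ybV (-1) t r * X)) * h16
  · set X := gmObservable (ybCurve (-1) t r) t (eraseFace Dl w) (w.side Side.S) (w.side Side.N)
    set Y := gmObservable (ybCurve (-1) t r) t (eraseFace Dl w) (w.side Side.N) (w.side Side.S)
    have slot : defectCoeff (ybCurve (-1) t r) t (oddCoeff r) .W .S * X +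
        defectCoeff (ybCurve (-1) t r) t (oddCoeff r) .W .N * Y = 0 := slot0
    rw [e1] at slot
    change Y = t ^ (-(8 : ℤ) * qTurn Side.E Side.S) * X
    rw [show (-(8 : ℤ)) * qTurn Side.E Side.S = -8 from by decide, (zs_neg_eight₃ h16)]
    apply mul_left_cancel₀ hv
    linear_combination t ^ 4 * slot + (-Y) * e2
  · set X := gmObservable (ybCurve (-1) t r) t (eraseFace Dl w) (w.side Side.W) (w.side Side.E)
    set Y := gmObservable (ybCurve (-1) t r) t (eraseFace Dl w) (w.side Side.E) (w.side Side.W)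
    have slot : defectCoeff (ybCurve (-1) t r) t (oddCoeff r) .N .W * X +
        defectCoeff (ybCurve (-1) t r) t (oddCoeff r) .N .E * Y = 0 := slot0
    rw [e7] at slot
    change Y = t ^ (-(8 : ℤ) * qTurn Side.S Side.W) * X
    rw [show (-(8 : ℤ)) * qTurn Side.S Side.W = -8 from by decide, (zs_neg_eight₃ h16)]
    have hne : r * ybV (-1) t r ≠ 0 := mul_ne_zero hr hv
    apply mul_left_cancel₀ hne
    linear_combination (-t ^ 4) * slot + Y * e8
  · set X := gmObservable (ybCurve (-1) t r) t (eraseFace Dl w) (w.side Side.W) (w.side Side.E)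
    set Y := gmObservable (ybCurve (-1) t r) t (eraseFace Dl w) (w.side Side.E) (w.side Side.W)
    have slot : defectCoeff (ybCurve (-1) t r) t (oddCoeff r) .S .W * X +
        defectCoeff (ybCurve (-1) t r) t (oddCoeff r) .S .E * Y = 0 := slot0
    rw [e6] at slot
    change Y = t ^ (-(8 : ℤ) * qTurn Side.N Side.W) * X
    rw [show (-(8 : ℤ)) * qTurn Side.N Side.W = 8 from by decide, zs_eight₃]
    have hne : r * ybV (-1) t r * t ^ 8 ≠ 0 := mul_ne_zero (mul_ne_zero hr hv) (pow_ne_zero _ ht)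
    apply mul_left_cancel₀ hne
    linear_combination t ^ 4 * slot + (-X) * e5 + (-(r * ybV (-1) t r * X)) * h16

/-- Part 2 at the hole root on the curve, two-term form: `VF_D(w.side σ, w) = dc(σ,ℓ)·X + dc(σ,ℓ.opp)·Y` (the
one-plaquette functional vanishes by F4 on `[w]`). [cite: GlazmanManolescu2019, Lemma 2.1 (statement, "in the form given in [Gl]"); Glazman2015WeightedSAW, Lemma 3.1 (proof)] -/
theorem vertexFunctional_spin_isthmus_root (h16 : t ^ 16 = -1) (hId : CurveIdentityAt t r) (Dl : List Face) (w : Face)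
    (σ : Side) (hw : w ∈ Dl) (hh : nbr w σ ∉ dom Dl) (hO : OuterRoot (dom Dl) (w.side σ.opp)) :
    vertexFunctional (ybCurve (-1) t r) t (oddCoeff r) Dl (w.side σ) w =
      defectCoeff (ybCurve (-1) t r) t (oddCoeff r) σ (lat σ) *
          gmObservable (ybCurve (-1) t r) t (eraseFace Dl w) (w.side (lat σ)) (w.side (lat σ).opp) +
        defectCoeff (ybCurve (-1) t r) t (oddCoeff r) σ (lat σ).opp *
          gmObservable (ybCurve (-1) t r) t (eraseFace Dl w) (w.side (lat σ).opp) (w.side (lat σ)) := by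
  rw [vertexFunctional_isthmus_root _ (spin_ne_zero₃ h16) _ hw hh (nbr_opp_not_mem hw hO),
    hId [w] (w.side σ) (outerRoot_single w σ) w (List.mem_singleton.2 rfl),
    zero_add, sum_lat]
  simp only [Side.opp_opp]

/-- ★★★ **The hole defect law on the curve** (`t = e^{−5iπ/16}`, any good `r`; unconditional in `v`):
`VF_D(w.side σ, w) = 2 · v · c_{σ.opp} · t^{−4·qTurn σ ℓ} · X`, `v = ybV (−1) t r`.
[cite: GlazmanManolescu2019, Lemma 2.1 (statement, "in the form given in [Gl]"); Glazman2015WeightedSAW, Lemma 3.1 (proof), eq. (1)] [cite: DuminilCopinSmirnov2012, proof of Lemma 1] -/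
theorem vertexFunctional_spin_isthmus_root_eq_slot (h16 : t ^ 16 = -1) (hr : r ≠ 0)
    (hD : t ^ 6 * (1 + r ^ 4) - (1 + t ^ 12) * r ^ 2 ≠ 0) (hId : CurveIdentityAt t r) (Dl : List Face) (w : Face)
    (σ : Side) (hw : w ∈ Dl) (hh : nbr w σ ∉ dom Dl) (hO : OuterRoot (dom Dl) (w.side σ.opp)) :
    vertexFunctional (ybCurve (-1) t r) t (oddCoeff r) Dl (w.side σ) w =
      2 * ybV (-1) t r * oddCoeff r (slotIdx σ.opp) * t ^ (-(4 : ℤ) * qTurn σ (lat σ)) *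
        gmObservable (ybCurve (-1) t r) t (eraseFace Dl w) (w.side (lat σ)) (w.side (lat σ).opp) := by
  have ht : t ≠ 0 := spin_ne_zero₃ h16
  obtain ⟨e1, e2, e3, e4, e5, e6, e7, e8⟩ :=
    defectCoeff_ybCurve_values (r := r) ht (spin_pow_four_ne_one₃ h16) hr hD
  have p2 := vertexFunctional_spin_isthmus_root h16 hId Dl w σ hw hh hO
  by_cases hv : ybV (-1) t r = 0
  · -- degenerate curve points: every defect coefficient vanishes with `v`
    have ht4 : t ^ 4 ≠ 0 := pow_ne_zero _ ht
    rw [hv] at e1 e2 e3 e4 e5 e6 e7 e8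
    rw [p2, hv]
    cases σ
    · change defectCoeff (ybCurve (-1) t r) t (oddCoeff r) .W .S * _ +
        defectCoeff (ybCurve (-1) t r) t (oddCoeff r) .W .N * _ = _
      rw [e1, (mul_eq_zero.1 e2).resolve_right ht4]; ring
    · change defectCoeff (ybCurve (-1) t r) t (oddCoeff r) .E .S * _ +
        defectCoeff (ybCurve (-1) t r) t (oddCoeff r) .E .N * _ = _
      rw [e4, show defectCoeff (ybCurve (-1) t r) t (oddCoeff r) .E .S = 0 from
        (mul_eq_zero.1 (e3.trans (by ring))).resolve_right ht4]; ring
    · change defectCoeff (ybCurve (-1) t r) t (oddCoeff r) .S .W * _ +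
        defectCoeff (ybCurve (-1) t r) t (oddCoeff r) .S .E * _ = _
      rw [e6, show defectCoeff (ybCurve (-1) t r) t (oddCoeff r) .S .W = 0 from
        (mul_eq_zero.1 (e5.trans (by ring))).resolve_right ht4]; ring
    · change defectCoeff (ybCurve (-1) t r) t (oddCoeff r) .N .W * _ +
        defectCoeff (ybCurve (-1) t r) t (oddCoeff r) .N .E * _ = _
      rw [e7, show defectCoeff (ybCurve (-1) t r) t (oddCoeff r) .N .E = 0 from
        (mul_eq_zero.1 (e8.trans (by ring))).resolve_right ht4]; ring
  · have rev := gmObservable_slot_reverse_spin h16 hr hD hId hv Dl w σ hw hh hO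
    cases σ
    · set X := gmObservable (ybCurve (-1) t r) t (eraseFace Dl w) (w.side Side.S) (w.side Side.N)
      set Y := gmObservable (ybCurve (-1) t r) t (eraseFace Dl w) (w.side Side.N) (w.side Side.S)
      change vertexFunctional (ybCurve (-1) t r) t (oddCoeff r) Dl (w.side Side.W) w =
        defectCoeff (ybCurve (-1) t r) t (oddCoeff r) .W .S * X +
          defectCoeff (ybCurve (-1) t r) t (oddCoeff r) .W .N * Y at p2
      change Y = t ^ (-(8 : ℤ) * qTurn Side.W Side.S) * X at rev
      rw [show (-(8 : ℤ)) * qTurn Side.W Side.S = 8 from by decide, zs_eight₃] at rev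
      change _ = 2 * ybV (-1) t r * oddCoeff r 0 * t ^ (-(4 : ℤ) * qTurn Side.W Side.S) * X
      rw [oc0₃, show (-(4 : ℤ)) * qTurn Side.W Side.S = 4 from by decide, zs_four₃]
      rw [e1] at p2
      linear_combination p2 + defectCoeff (ybCurve (-1) t r) t (oddCoeff r) .W .N * rev +
        (t ^ 4 * X) * e2
    · set X := gmObservable (ybCurve (-1) t r) t (eraseFace Dl w) (w.side Side.S) (w.side Side.N)
      set Y := gmObservable (ybCurve (-1) t r) t (eraseFace Dl w) (w.side Side.N) (w.side Side.S)
      change vertexFunctional (ybCurve (-1) t r) t (oddCoeff r) Dl (w.side Side.E) w =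
        defectCoeff (ybCurve (-1) t r) t (oddCoeff r) .E .S * X +
          defectCoeff (ybCurve (-1) t r) t (oddCoeff r) .E .N * Y at p2
      change Y = t ^ (-(8 : ℤ) * qTurn Side.E Side.S) * X at rev
      rw [show (-(8 : ℤ)) * qTurn Side.E Side.S = -8 from by decide, (zs_neg_eight₃ h16)] at rev
      change _ = 2 * ybV (-1) t r * oddCoeff r 2 * t ^ (-(4 : ℤ) * qTurn Side.E Side.S) * X
      rw [oc2₃, show (-(4 : ℤ)) * qTurn Side.E Side.S = -4 from by decide, (zs_neg_four₃ h16)]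
      rw [e4] at p2
      linear_combination p2 + (-(ybV (-1) t r * t ^ 4)) * rev + (-(X * t ^ 12)) * e3 +
        (X * defectCoeff (ybCurve (-1) t r) t (oddCoeff r) .E .S) * h16
    · set X := gmObservable (ybCurve (-1) t r) t (eraseFace Dl w) (w.side Side.W) (w.side Side.E)
      set Y := gmObservable (ybCurve (-1) t r) t (eraseFace Dl w) (w.side Side.E) (w.side Side.W)
      change vertexFunctional (ybCurve (-1) t r) t (oddCoeff r) Dl (w.side Side.S) w =
        defectCoeff (ybCurve (-1) t r) t (oddCoeff r) .S .W * X +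
          defectCoeff (ybCurve (-1) t r) t (oddCoeff r) .S .E * Y at p2
      change Y = t ^ (-(8 : ℤ) * qTurn Side.S Side.W) * X at rev
      rw [show (-(8 : ℤ)) * qTurn Side.S Side.W = -8 from by decide, (zs_neg_eight₃ h16)] at rev
      change _ = 2 * ybV (-1) t r * oddCoeff r 1 * t ^ (-(4 : ℤ) * qTurn Side.S Side.W) * X
      rw [oc1₃, show (-(4 : ℤ)) * qTurn Side.S Side.W = -4 from by decide, (zs_neg_four₃ h16)]
      rw [e6] at p2
      linear_combination p2 + (r * ybV (-1) t r * t ^ 4) * rev +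
        (X * defectCoeff (ybCurve (-1) t r) t (oddCoeff r) .S .W) * h16 + (-(X * t ^ 12)) * e5
    · set X := gmObservable (ybCurve (-1) t r) t (eraseFace Dl w) (w.side Side.W) (w.side Side.E)
      set Y := gmObservable (ybCurve (-1) t r) t (eraseFace Dl w) (w.side Side.E) (w.side Side.W)
      change vertexFunctional (ybCurve (-1) t r) t (oddCoeff r) Dl (w.side Side.N) w =
        defectCoeff (ybCurve (-1) t r) t (oddCoeff r) .N .W * X +
          defectCoeff (ybCurve (-1) t r) t (oddCoeff r) .N .E * Y at p2
      change Y = t ^ (-(8 : ℤ) * qTurn Side.N Side.W) * X at rev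
      rw [show (-(8 : ℤ)) * qTurn Side.N Side.W = 8 from by decide, zs_eight₃] at rev
      change _ = 2 * ybV (-1) t r * oddCoeff r 3 * t ^ (-(4 : ℤ) * qTurn Side.N Side.W) * X
      rw [oc3₃, show (-(4 : ℤ)) * qTurn Side.N Side.W = 4 from by decide, zs_four₃]
      rw [e7] at p2
      linear_combination p2 + defectCoeff (ybCurve (-1) t r) t (oddCoeff r) .N .E * rev +
        (t ^ 4 * X) * e8

/-- ★★★ **The modulus law on the curve**: `‖VF_D(w.side σ, w)‖ = 2·‖v‖·‖c_{σ.opp}‖·‖X‖` (`‖c_{σ.opp}‖ = 1` for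
`σ ∈ {W, E}`, `‖r‖` for `σ ∈ {S, N}`). [cite: GlazmanManolescu2019, Lemma 2.1 (statement, "in the form given in [Gl]"); Glazman2015WeightedSAW, Lemma 3.1 (proof), eq. (1)] [cite: DuminilCopinSmirnov2012, proof of Lemma 1] -/
theorem norm_vertexFunctional_spin_isthmus_root (h16 : t ^ 16 = -1) (ht1 : ‖t‖ = 1) (hr : r ≠ 0)
    (hD : t ^ 6 * (1 + r ^ 4) - (1 + t ^ 12) * r ^ 2 ≠ 0) (hId : CurveIdentityAt t r) (Dl : List Face) (w : Face)
    (σ : Side) (hw : w ∈ Dl) (hh : nbr w σ ∉ dom Dl) (hO : OuterRoot (dom Dl) (w.side σ.opp)) :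
    ‖vertexFunctional (ybCurve (-1) t r) t (oddCoeff r) Dl (w.side σ) w‖ =
      2 * ‖ybV (-1) t r‖ * ‖oddCoeff r (slotIdx σ.opp)‖ *
        ‖gmObservable (ybCurve (-1) t r) t (eraseFace Dl w) (w.side (lat σ)) (w.side (lat σ).opp)‖ := by
  rw [vertexFunctional_spin_isthmus_root_eq_slot h16 hr hD hId Dl w σ hw hh hO, norm_mul, norm_mul, norm_mul, norm_mul,
    norm_zpow, ht1, one_zpow, mul_one]
  norm_num

end AllSpins

end Literature.Barriers.CriticalPhenomena.PlaquetteWalk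

/-! ## Part 3f — winding constancy of the slot-crossing walks, and the phase-free defect law

The tree's excursion-winding theorem (`ExcursionWindingGen`, discharged for outer roots by
`excursionWindingGen_of_rootUnwound ∘ rootUnwound_of_outerRoot`, YangBaxterSAWGeneralDomain — the
Hopf-Umlaufsatz input of the grouping proof) applied at the rhombus `w` for the OUTER root `w.side σ.opp`:
a slot-crossing walk `δ` of `D ∖ {w}` from `w.side ℓ` to `w.side ℓ.opp`, with the root arc `σ.opp → ℓ`
prepended, is a walk of class `B2a` at `w` (first hit of `∂w` at the root, one arc in `w`, an excursion
that meets `∂w` again only at its end), so the winding of `δ` is the tabulated excursion winding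
`excursionWinding (π/2) σ.opp ℓ ℓ.opp = ∓2π` (`slot_winding_eq`). Hence `t^{q(δ)} = t^{4·qTurn σ ℓ}` for EVERY
slot-crossing `δ` (`tFiveEighths_zpow_slot`), the slot observable is that phase times the plain weight sum
`B = Σ_δ weightL(δ)` (`gmObservable_slot_eq_phase_mul_weightSum`), and the phases cancel in the defect law:
★★★★ `vertexFunctional_printed_isthmus_root_eq_weightSum`:
**`VF_D(w.side σ, w) = 2 · v(θ) · c_{σ.opp} · Σ_{δ : slot-crossing walks of D∖{w}} w_θ(δ)`** for every
`θ ∈ [π/3, 2π/3]` — the defect of the Yang–Baxter vertex identity at the root plaquette of an isthmus hole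
root is twice the straight-arc weight times the total weight of the walks of `D ∖ {w}` joining the two
sides of the slot (around the hole), up to the unit `c_{σ.opp} ∈ {±1, ±r(θ)}`.
-/

namespace Literature.Barriers.CriticalPhenomena.PlaquetteWalk

open Literature.Probability.RandomPlanarGeometry.SAW.YangBaxter
open Literature.Probability.RandomPlanarGeometry.SAW.YangBaxter.MidEdge
open Literature.Probability.RandomPlanarGeometry.SAW

section Winding

variable {Dl : List Face} {w : Face} {σ : Side}

/-- Every side is the hole side, its opposite, the lateral side or its opposite. [folklore] -/
private theorem side_cases₃ (σ u : Side) : u = σ ∨ u = σ.opp ∨ u = lat σ ∨ u = (lat σ).opp := by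
  cases σ <;> cases u <;> decide

/-- **A slot-crossing walk of `D ∖ {w}` meets `∂w` only at its two ends.** [folklore] -/
private theorem slot_nth_ne_side₃ (hh : nbr w σ ∉ dom Dl) (ho : nbr w σ.opp ∉ dom Dl)
    (δ : YBWalk (dom (eraseFace Dl w)) (w.side (lat σ)) (w.side (lat σ).opp)) {j : ℕ} (hj0 : 0 < j)
    (hj : j < δ.arcs.length) (u : Side) : δ.nth j ≠ w.side u := by
  obtain ⟨hl1, hl2, -, -, -, -⟩ := lat_facts σ
  rcases side_cases₃ σ u with rfl | rfl | rfl | rfl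
  · exact nth_ne_root hh hl1 δ hj.le
  · exact nth_ne_root ho hl2 δ hj.le
  · intro e
    have := δ.nth_inj hj.le (Nat.zero_le _) (e.trans δ.nth_zero.symm)
    omega
  · intro e
    have := δ.nth_inj hj.le le_rfl (e.trans δ.nth_length.symm)
    omega

/-- ★ **Winding constancy of the slot-crossing walks**: every walk of `D ∖ {w}` from `w.side ℓ` to
`w.side ℓ.opp` (`ℓ = lat σ`; plaquettes across `σ` and `σ.opp` missing, `w.side σ.opp` an outer root) has
square-frame winding `excursionWinding (π/2) σ.opp ℓ ℓ.opp` (`= ∓2π`): the tree's excursion-winding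
theorem for the OUTER root `w.side σ.opp` at the rhombus `w`, applied to the walk with the root arc
`σ.opp → ℓ` prepended (class `B2a`). [cite: GlazmanManolescu2019, Lemma 2.1 (statement, "in the form given in [Gl]"); Glazman2015WeightedSAW, Lemma 3.1 (proof: the excursion windings)] [cite: DuminilCopinSmirnov2012, proof of Lemma 1 («a is on the boundary and Ω is simply connected»)] -/
theorem slot_winding_eq (hw : w ∈ Dl) (hh : nbr w σ ∉ dom Dl) (hO : OuterRoot (dom Dl) (w.side σ.opp))
    (δ : YBWalk (dom (eraseFace Dl w)) (w.side (lat σ)) (w.side (lat σ).opp)) :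
    δ.winding (fun _ => π / 2) = excursionWinding (π / 2) σ.opp (lat σ) (lat σ).opp := by
  obtain ⟨hl1, hl2, hl3, hl4, hl5, hoσ⟩ := lat_facts σ
  have ho : nbr w σ.opp ∉ dom Dl := nbr_opp_not_mem hw hO
  have hδpos : 0 < δ.arcs.length := arcs_pos_of_lateral δ
  -- the walk from the outer root: the root arc `σ.opp → lat σ`, then `δ`
  set γ : YBWalk (dom Dl) (w.side σ.opp) (w.side (lat σ).opp) := consWalk hw ho hl2 δ with hγ
  have hmids : γ.mids = w.side σ.opp :: δ.mids := consWalk_mids hw ho hl2 δ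
  have hlen : γ.arcs.length = δ.arcs.length + 1 := by
    have h1 := γ.length_eq
    have h2 := δ.length_eq
    rw [hmids, List.length_cons] at h1
    omega
  have hnth : ∀ i ≤ δ.arcs.length, γ.nth (i + 1) = δ.nth i := by
    intro i hi
    rw [γ.nth_eq_getElem (by rw [γ.length_eq, hlen]; omega), δ.nth_eq_getElem (by rw [δ.length_eq]; omega)]
    simp [hmids]
  -- `w` seen from the outer root
  have hr : RootedFace (dom Dl) (w.side σ.opp) w := ⟨hw, hO.not_interior⟩
  -- the first hit of `∂w` is the root itself
  have h0 : 0 ∈ γ.hitIdx w := (YBWalk.mem_hitIdx γ w).2 ⟨Nat.zero_le _, σ.opp, γ.nth_zero⟩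
  have hfh : γ.firstHitG = 0 := by
    apply Nat.le_zero.1
    unfold YBWalk.firstHitG
    exact Finset.min'_le _ _ h0
  have hB2 : γ.firstHitG + 1 < γ.arcs.length := by rw [hfh, hlen]; omega
  -- the excursion `δ` meets `∂w` again only at its end
  have hlater : ∀ i ∈ γ.laterHitsG, i = γ.arcs.length := by
    intro i hi
    unfold YBWalk.laterHitsG at hi
    rw [Finset.mem_filter, hfh] at hi
    obtain ⟨hi1, hi2⟩ := hi
    obtain ⟨hile, u, hu⟩ := (YBWalk.mem_hitIdx γ w).1 hi1
    by_contra hne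
    obtain ⟨j, rfl⟩ : ∃ j, i = j + 1 := ⟨i - 1, by omega⟩
    rw [hlen] at hile hne
    rw [hnth j (by omega)] at hu
    exact slot_nth_ne_side₃ hh ho δ (by omega) (by omega) u hu
  have hret : γ.returnHitG hB2 = γ.arcs.length := by
    apply hlater
    unfold YBWalk.returnHitG
    exact Finset.min'_mem _ _
  -- the tree's excursion-winding theorem at the outer root
  have hW := excursionWindingGen_of_rootUnwound (rootUnwound_of_outerRoot hO)
  have hΘ : ∀ k : ℤ, (fun _ : ℤ => π / 2) k ∈ Set.Icc (π / 3) (2 * π / 3) :=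
    fun _ => ⟨by linarith [Real.pi_pos], by linarith [Real.pi_pos]⟩
  have hB2a : ∃ h : γ.firstHitG + 1 < γ.arcs.length, γ.returnHitG h = γ.arcs.length := ⟨hB2, hret⟩
  have key := hW (fun _ => π / 2) hΘ w hr ⟨(lat σ).opp, γ⟩ hB2a
  -- the first side is the root side, the exit side is the lateral side
  have hfs : γ.firstSideG = σ.opp := by
    have spec : γ.nth γ.firstHitG = w.side γ.firstSideG :=
      Classical.choose_spec ((YBWalk.mem_hitIdx γ w).1 (Finset.min'_mem _ _)).2
    rw [hfh, γ.nth_zero] at spec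
    exact (Face.side_injective w spec).symm
  have hex : ∀ h, γ.exitSideG hr h = lat σ := by
    intro h
    have e : arcFace (γ.nth γ.firstHitG, γ.nth (γ.firstHitG + 1)) = some w := by
      rw [hfh, γ.nth_zero, show (0 : ℕ) + 1 = 0 + 1 from rfl, hnth 0 (by omega), δ.nth_zero]
      exact arcFace_side_side w σ.opp (lat σ) hl2.symm
    obtain ⟨-, -, h2, -⟩ := Classical.choose_spec (Classical.choose_spec (exists_sides_of_arcFace e))
    have h2' : w.side (γ.exitSideG hr h) = γ.nth (γ.firstHitG + 1) := h2
    rw [hfh, show (0 : ℕ) + 1 = 0 + 1 from rfl, hnth 0 (by omega), δ.nth_zero] at h2'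
    exact Face.side_injective w h2'
  -- the excursion winding is the winding of `δ`
  have hWE : ΩG.WE ⟨(lat σ).opp, γ⟩ (fun _ => π / 2) = δ.winding (fun _ => π / 2) := by
    unfold ΩG.WE YBWalk.winding
    change (((γ.arcs.drop (γ.firstHitG + 1)).map (arcTurnOf fun _ => π / 2))).sum = _
    rw [hfh]
    obtain ⟨rest, hrest⟩ : ∃ rest, δ.mids = w.side (lat σ) :: rest := by
      have h := δ.head_eq
      cases hm : δ.mids with
      | nil => rw [hm] at h; simp at h
      | cons x rest => rw [hm] at h; simp at h; exact ⟨rest, by rw [h]⟩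
    have harcs : γ.arcs = (w.side σ.opp, w.side (lat σ)) :: δ.arcs := by
      change arcsOf γ.mids = _ :: arcsOf δ.mids
      rw [hmids, hrest, arcsOf_cons_cons]
    rw [harcs]
    rfl
  rw [← hWE, key, hfs, hex]

/-- `excursionWinding (π/2) σ.opp ℓ ℓ.opp = −(π/2)·(4·qTurn σ ℓ)`: `∓2π`. [cite: GlazmanManolescu2019, Lemma 2.1 (statement, "in the form given in [Gl]"); Glazman2015WeightedSAW, Lemma 3.1 (proof: the excursion windings)] -/
private theorem excursionWinding_slot₃ (σ : Side) :
    excursionWinding (π / 2) σ.opp (lat σ) (lat σ).opp = -(π / 2) * ((-(4 : ℤ) * qTurn σ (lat σ) : ℤ) : ℝ) := by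
  cases σ <;> simp [excursionWinding, lat, Side.opp, qTurn] <;> ring

/-- ★★ **The phase of every slot-crossing walk is `t^{4·qTurn σ ℓ}`** (`t = e^{−5iπ/16}`): winding `∓4`
quarter turns. [cite: GlazmanManolescu2019, Lemma 2.1 (statement, "in the form given in [Gl]"); Glazman2015WeightedSAW, Lemma 3.1 (proof); §2.1, eq. (2.1)] -/
theorem tFiveEighths_zpow_slot (hw : w ∈ Dl) (hh : nbr w σ ∉ dom Dl) (hO : OuterRoot (dom Dl) (w.side σ.opp))
    (δ : YBWalk (dom (eraseFace Dl w)) (w.side (lat σ)) (w.side (lat σ).opp)) :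
    tFiveEighths ^ quarterTurnsL δ.mids = tFiveEighths ^ ((4 : ℤ) * qTurn σ (lat σ)) := by
  rw [tFiveEighths_zpow_eq δ, slot_winding_eq hw hh hO δ, excursionWinding_slot₃, tFiveEighths,
    ← Complex.exp_int_mul]
  congr 1
  push_cast
  ring

/-- ★★ **The slot observable is one phase times the plain weight sum**:
`G_{D∖w}(w.side ℓ → w.side ℓ.opp) = t^{4·qTurn σ ℓ} · Σ_δ weightL(δ)` (any weights `W`, `t = e^{−5iπ/16}`).
[cite: GlazmanManolescu2019, §2.1, eq. (2.1)] -/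
theorem gmObservable_slot_eq_phase_mul_weightSum (W : CWeights) (hw : w ∈ Dl) (hh : nbr w σ ∉ dom Dl)
    (hO : OuterRoot (dom Dl) (w.side σ.opp)) :
    gmObservable W tFiveEighths (eraseFace Dl w) (w.side (lat σ)) (w.side (lat σ).opp) =
      tFiveEighths ^ ((4 : ℤ) * qTurn σ (lat σ)) *
        ∑ δ : YBWalk (dom (eraseFace Dl w)) (w.side (lat σ)) (w.side (lat σ).opp), weightL W δ.mids := by
  unfold gmObservable
  rw [Finset.mul_sum]
  refine Finset.sum_congr rfl fun δ _ => ?_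
  rw [tFiveEighths_zpow_slot hw hh hO δ]
  ring

/-- ★★★★ **The phase-free hole defect law**: for every `θ ∈ [π/3, 2π/3]`, every finite face list and every
isthmus hole root, `VF_D(w.side σ, w) = 2 · v(θ) · c_{σ.opp} · Σ_{δ} w_θ(δ)`, the sum over ALL walks of
`D ∖ {w}` from `w.side ℓ` to `w.side ℓ.opp` (`ℓ = lat σ`) of their plaquette weights — the phases `t^{−4q}`
of the defect law and `t^{4q}` of the slot-crossing walks cancel. [cite: GlazmanManolescu2019, Lemma 2.1 (statement, "in the form given in [Gl]"); Glazman2015WeightedSAW, Lemma 3.1 (proof), eq. (1)] [cite: DuminilCopinSmirnov2012, proof of Lemma 1 («we used the fact that a is on the boundary and Ω is simply connected»)] -/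
theorem vertexFunctional_printed_isthmus_root_eq_weightSum {θ : ℝ} (hθ : θ ∈ Set.Icc (π / 3) (2 * π / 3))
    (Dl : List Face) (w : Face) (σ : Side) (hw : w ∈ Dl) (hh : nbr w σ ∉ dom Dl)
    (hO : OuterRoot (dom Dl) (w.side σ.opp)) :
    vertexFunctional (printedWeights θ) tFiveEighths (ybCoeff θ) Dl (w.side σ) w =
      2 * (weightV θ : ℂ) * ybCoeff θ (slotIdx σ.opp) *
        ∑ δ : YBWalk (dom (eraseFace Dl w)) (w.side (lat σ)) (w.side (lat σ).opp), weightL (printedWeights θ) δ.mids := by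
  rw [vertexFunctional_printed_isthmus_root_eq_slot hθ Dl w σ hw hh hO,
    gmObservable_slot_eq_phase_mul_weightSum (printedWeights θ) hw hh hO, mul_assoc, ← mul_assoc (tFiveEighths ^ _),
    ← zpow_add₀ tFiveEighths_ne_zero, show -(4 : ℤ) * qTurn σ (lat σ) + 4 * qTurn σ (lat σ) = 0 by ring, zpow_zero, one_mul]

/-- ★★★★ **The phase-free modulus law**: `‖VF_D(w.side σ, w)‖ = 2·|v(θ)|·‖Σ_δ w_θ(δ)‖` (the weight sum of the
slot-crossing walks; its terms are products of the nonnegative printed weights). [cite: GlazmanManolescu2019, Lemma 2.1 (statement, "in the form given in [Gl]"); Glazman2015WeightedSAW, Lemma 3.1 (proof), eq. (1)] [cite: DuminilCopinSmirnov2012, proof of Lemma 1] -/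
theorem norm_vertexFunctional_printed_isthmus_root_weightSum {θ : ℝ} (hθ : θ ∈ Set.Icc (π / 3) (2 * π / 3))
    (Dl : List Face) (w : Face) (σ : Side) (hw : w ∈ Dl) (hh : nbr w σ ∉ dom Dl)
    (hO : OuterRoot (dom Dl) (w.side σ.opp)) :
    ‖vertexFunctional (printedWeights θ) tFiveEighths (ybCoeff θ) Dl (w.side σ) w‖ =
      2 * |weightV θ| *
        ‖∑ δ : YBWalk (dom (eraseFace Dl w)) (w.side (lat σ)) (w.side (lat σ).opp), weightL (printedWeights θ) δ.mids‖ := by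
  rw [vertexFunctional_printed_isthmus_root_eq_weightSum hθ Dl w σ hw hh hO, norm_mul, norm_mul, norm_mul,
    norm_ybCoeff_slotIdx₃, mul_one, Complex.norm_real, Real.norm_eq_abs]
  norm_num

end Winding

end Literature.Barriers.CriticalPhenomena.PlaquetteWalk

/-! ## Part 3g — the weight sum is a nonnegative real: the defect law in final form

For the printed weights (all five nonnegative on `[π/3, 2π/3]`, tree `weightU1_nonneg` … `weightW2_nonneg`;
`v(θ) ≥ v(π/3) = x_c² > 0`, tree `weightV_pi_div_three_le`), the weight of a walk is a nonnegative real and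
so is the slot weight sum `B_θ(D, w, σ) = Σ_{δ : w.side ℓ → w.side ℓ.opp in D ∖ {w}} w_θ(δ)` (`slotWeightSum`).
Final form of the hole defect law, for every `θ ∈ [π/3, 2π/3]`, every finite face list, every isthmus hole root:
★★★★ `VF_D(w.side σ, w) = 2·v(θ)·c_{σ.opp}·B_θ(D,w,σ)` with `B ≥ 0` real (`vertexFunctional_printed_isthmus_root_eq_real`),
`‖VF_D(w.side σ, w)‖ = 2·v(θ)·B_θ(D,w,σ)` (`norm_vertexFunctional_printed_isthmus_root_eq`), and
`VF = 0 ↔ B = 0` (`…_eq_zero_iff_weightSum`): the Yang–Baxter vertex identity holds at the root plaquette of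
an isthmus hole root iff every walk of `D ∖ {w}` around the hole between the two sides of the slot has weight
zero (for `θ ∈ (π/3, 2π/3)` all five weights are positive, so: iff there is NO such walk — the pinch case).
-/

namespace Literature.Barriers.CriticalPhenomena.PlaquetteWalk

open Literature.Probability.RandomPlanarGeometry.SAW.YangBaxter
open Literature.Probability.RandomPlanarGeometry.SAW.YangBaxter.MidEdge
open Literature.Probability.RandomPlanarGeometry.SAW

section RealWeights

variable {Dl : List Face} {w : Face} {σ : Side}

/-- The weight of a mid-edge list at the printed weights, as a real number:
`u₁^{n₁} u₂^{n₂} v^{n_v} w₁^{m₁} w₂^{m₂}`. [cite: GlazmanManolescu2019, eq. (1), §2.1 eq. (2.1)] -/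
def realWeightL (θ : ℝ) (l : List MidEdge) : ℝ :=
  weightU1 θ ^ cfgCount l [.corner] * weightU2 θ ^ cfgCount l [.coCorner] * weightV θ ^ cfgCount l [.straight] *
    weightW1 θ ^ cfgCount l [.corner, .corner] * weightW2 θ ^ cfgCount l [.coCorner, .coCorner]

/-- The complex weight at the printed weights is the real weight. [cite: GlazmanManolescu2019, eq. (1)] -/
theorem weightL_printed_eq_ofReal (θ : ℝ) (l : List MidEdge) :
    weightL (printedWeights θ) l = (realWeightL θ l : ℂ) := by
  simp only [weightL, CWeights.mono, printedWeights, realWeightL]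
  push_cast
  ring

/-- The real weight is nonnegative on the printed range. [cite: GlazmanManolescu2019, eq. (1) (nonnegativity on [π/3, 2π/3])] -/
theorem realWeightL_nonneg {θ : ℝ} (hθ : θ ∈ Set.Icc (π / 3) (2 * π / 3)) (l : List MidEdge) : 0 ≤ realWeightL θ l := by
  unfold realWeightL
  have h1 := weightU1_nonneg hθ
  have h2 := weightU2_nonneg hθ
  have h3 := weightV_nonneg hθ
  have h4 := weightW1_nonneg hθ
  have h5 := weightW2_nonneg hθ
  positivity

/-- **The slot weight sum** `B_θ(D, w, σ) = Σ_δ w_θ(δ)` over the walks of `D ∖ {w}` from `w.side ℓ` to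
`w.side ℓ.opp`, `ℓ = lat σ` (a plain generating function, no phases). [cite: GlazmanManolescu2019, §2.1, eq. (2.1)] -/
def slotWeightSum (θ : ℝ) (Dl : List Face) (w : Face) (σ : Side) : ℝ :=
  ∑ δ : YBWalk (dom (eraseFace Dl w)) (w.side (lat σ)) (w.side (lat σ).opp), realWeightL θ δ.mids

/-- `B_θ ≥ 0`. [cite: GlazmanManolescu2019, eq. (1)] -/
theorem slotWeightSum_nonneg {θ : ℝ} (hθ : θ ∈ Set.Icc (π / 3) (2 * π / 3)) (Dl : List Face) (w : Face) (σ : Side) :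
    0 ≤ slotWeightSum θ Dl w σ :=
  Finset.sum_nonneg fun δ _ => realWeightL_nonneg hθ δ.mids

/-- The complex weight sum is the real slot weight sum. [cite: GlazmanManolescu2019, §2.1, eq. (2.1)] -/
theorem sum_weightL_printed_eq (θ : ℝ) (Dl : List Face) (w : Face) (σ : Side) :
    ∑ δ : YBWalk (dom (eraseFace Dl w)) (w.side (lat σ)) (w.side (lat σ).opp), weightL (printedWeights θ) δ.mids =
      (slotWeightSum θ Dl w σ : ℂ) := by
  unfold slotWeightSum
  rw [Complex.ofReal_sum]
  exact Finset.sum_congr rfl fun δ _ => weightL_printed_eq_ofReal θ δ.mids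

/-- `v(θ) > 0` on the printed range (`v(θ) ≥ v(π/3) = x_c²`, tree). [cite: GlazmanManolescu2019, eq. (1), §1 Fig. 2] -/
theorem weightV_pos_of_mem {θ : ℝ} (hθ : θ ∈ Set.Icc (π / 3) (2 * π / 3)) : 0 < weightV θ := by
  have hx : 0 < hexCriticalFugacity := hexCriticalFugacity_pos_lt_one.1
  have h0 : 0 < weightV (π / 3) := by rw [weightV_pi_div_three]; positivity
  exact lt_of_lt_of_le h0 (weightV_pi_div_three_le hθ)

/-- ★★★★ **The hole defect law, final form**: for every `θ ∈ [π/3, 2π/3]`, every finite face list and every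
isthmus hole root (plaquette across `σ` missing, `w.side σ.opp` an outer root),
`VF_D(w.side σ, w) = 2 · v(θ) · c_{σ.opp} · B_θ(D, w, σ)` with `B_θ(D,w,σ) ≥ 0` the total weight of the walks of
`D ∖ {w}` between the two sides of the slot. [cite: GlazmanManolescu2019, Lemma 2.1 (statement, "in the form given in [Gl]"); Glazman2015WeightedSAW, Lemma 3.1 (proof), eq. (1)] [cite: DuminilCopinSmirnov2012, proof of Lemma 1 («we used the fact that a is on the boundary and Ω is simply connected»)] -/
theorem vertexFunctional_printed_isthmus_root_eq_real {θ : ℝ} (hθ : θ ∈ Set.Icc (π / 3) (2 * π / 3))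
    (Dl : List Face) (w : Face) (σ : Side) (hw : w ∈ Dl) (hh : nbr w σ ∉ dom Dl)
    (hO : OuterRoot (dom Dl) (w.side σ.opp)) :
    vertexFunctional (printedWeights θ) tFiveEighths (ybCoeff θ) Dl (w.side σ) w =
      2 * (weightV θ : ℂ) * ybCoeff θ (slotIdx σ.opp) * (slotWeightSum θ Dl w σ : ℂ) := by
  rw [vertexFunctional_printed_isthmus_root_eq_weightSum hθ Dl w σ hw hh hO, sum_weightL_printed_eq]

/-- ★★★★ **The modulus of the hole defect**: `‖VF_D(w.side σ, w)‖ = 2 · v(θ) · B_θ(D, w, σ)`.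
[cite: GlazmanManolescu2019, Lemma 2.1 (statement, "in the form given in [Gl]"); Glazman2015WeightedSAW, Lemma 3.1 (proof), eq. (1)] [cite: DuminilCopinSmirnov2012, proof of Lemma 1] -/
theorem norm_vertexFunctional_printed_isthmus_root_eq {θ : ℝ} (hθ : θ ∈ Set.Icc (π / 3) (2 * π / 3))
    (Dl : List Face) (w : Face) (σ : Side) (hw : w ∈ Dl) (hh : nbr w σ ∉ dom Dl)
    (hO : OuterRoot (dom Dl) (w.side σ.opp)) :
    ‖vertexFunctional (printedWeights θ) tFiveEighths (ybCoeff θ) Dl (w.side σ) w‖ =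
      2 * weightV θ * slotWeightSum θ Dl w σ := by
  rw [vertexFunctional_printed_isthmus_root_eq_real hθ Dl w σ hw hh hO, norm_mul, norm_mul, norm_mul,
    norm_ybCoeff_slotIdx₃, mul_one, Complex.norm_real, Complex.norm_real, Real.norm_eq_abs, Real.norm_eq_abs,
    abs_of_pos (weightV_pos_of_mem hθ), abs_of_nonneg (slotWeightSum_nonneg hθ Dl w σ)]
  norm_num

/-- ★★★★ **The Yang–Baxter vertex identity at the root plaquette of an isthmus hole root holds iff the slot
weight sum vanishes** (iff every walk of `D ∖ {w}` joining the two sides of the slot has weight zero).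
[cite: DuminilCopinSmirnov2012, proof of Lemma 1] [cite: GlazmanManolescu2019, Lemma 2.1] -/
theorem vertexFunctional_printed_isthmus_root_eq_zero_iff_weightSum {θ : ℝ} (hθ : θ ∈ Set.Icc (π / 3) (2 * π / 3))
    (Dl : List Face) (w : Face) (σ : Side) (hw : w ∈ Dl) (hh : nbr w σ ∉ dom Dl)
    (hO : OuterRoot (dom Dl) (w.side σ.opp)) :
    vertexFunctional (printedWeights θ) tFiveEighths (ybCoeff θ) Dl (w.side σ) w = 0 ↔ slotWeightSum θ Dl w σ = 0 := by
  rw [← norm_eq_zero, norm_vertexFunctional_printed_isthmus_root_eq hθ Dl w σ hw hh hO]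
  have hv := weightV_pos_of_mem hθ
  constructor
  · intro h
    rcases mul_eq_zero.1 h with h' | h'
    · exact absurd h' (mul_ne_zero two_ne_zero hv.ne')
    · exact h'
  · intro h
    rw [h, mul_zero]

end RealWeights

end Literature.Barriers.CriticalPhenomena.PlaquetteWalk

/-! ## Part 3h — strict positivity on the open range: the identity holds iff NO walk crosses the slot

For `θ ∈ (π/3, 2π/3)` all five printed weights are strictly positive (`u₁, u₂`: tree `weightU1_pos`/`weightU2_pos`;
`v`: `weightV_pos_of_mem`; `w₁, w₂`: below), so every walk has positive weight and
`B_θ(D,w,σ) = 0 ↔` there is no walk of `D ∖ {w}` from `w.side ℓ` to `w.side ℓ.opp` at all. Hence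
★★★★ `vertexFunctional_printed_isthmus_root_eq_zero_iff_isEmpty`: on the open printed range, the Yang–Baxter
vertex identity holds at the root plaquette of an isthmus hole root IFF the two sides of the slot are NOT joined
by any self-avoiding plaquette walk of `D ∖ {w}` (the pinch case) — a purely combinatorial criterion.
-/

namespace Literature.Barriers.CriticalPhenomena.PlaquetteWalk

open Literature.Probability.RandomPlanarGeometry.SAW.YangBaxter
open Literature.Probability.RandomPlanarGeometry.SAW.YangBaxter.MidEdge
open Literature.Probability.RandomPlanarGeometry.SAW

section StrictPositivity

variable {Dl : List Face} {w : Face} {σ : Side}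

/-- `w₁(θ) > 0` for `θ ∈ [π/3, 2π/3)` (it vanishes at `2π/3`). [cite: GlazmanManolescu2019, §1] -/
theorem weightW1_pos_of_mem {θ : ℝ} (hθ : θ ∈ Set.Icc (π / 3) (2 * π / 3)) (hθ' : θ < 2 * π / 3) :
    0 < weightW1 θ := by
  obtain ⟨h1, h2⟩ := three_mul_div_eight_mem hθ
  have hpi := Real.pi_pos
  refine div_pos_of_neg_of_neg (mul_neg_of_pos_of_neg (sin_five_pi_div_eight_add_pos hθ) ?_) (weightDen_neg hθ)
  rw [show 5 * π / 4 - 3 * θ / 8 = (π / 4 - 3 * θ / 8) + π by ring, sin_add_pi, neg_lt_zero]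
  exact sin_pos_of_pos_of_lt_pi (by linarith) (by linarith)

/-- `w₂(θ) > 0` for `θ ∈ (π/3, 2π/3]` (it vanishes at `π/3`). [cite: GlazmanManolescu2019, §1] -/
theorem weightW2_pos_of_mem {θ : ℝ} (hθ : θ ∈ Set.Icc (π / 3) (2 * π / 3)) (hθ' : π / 3 < θ) :
    0 < weightW2 θ := by
  obtain ⟨h1, h2⟩ := three_mul_div_eight_mem hθ
  have hpi := Real.pi_pos
  refine div_pos_of_neg_of_neg (mul_neg_of_pos_of_neg ?_ ?_) (weightDen_neg hθ)
  · rw [show 15 * π / 8 + 3 * θ / 8 = (3 * θ / 8 - π / 8) + 2 * π by ring, sin_add_two_pi]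
    exact sin_pos_of_pos_of_lt_pi (by linarith) (by linarith)
  · rw [sin_neg, neg_lt_zero]; exact sin_three_mul_div_eight_pos hθ

/-- On the OPEN range every walk has strictly positive weight. [cite: GlazmanManolescu2019, §1, eq. (1)] -/
theorem realWeightL_pos {θ : ℝ} (hθ : θ ∈ Set.Ioo (π / 3) (2 * π / 3)) (l : List MidEdge) : 0 < realWeightL θ l := by
  have hθ' : θ ∈ Set.Icc (π / 3) (2 * π / 3) := Set.Ioo_subset_Icc_self hθ
  unfold realWeightL
  have h1 := weightU1_pos hθ'
  have h2 := weightU2_pos hθ'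
  have h3 := weightV_pos_of_mem hθ'
  have h4 := weightW1_pos_of_mem hθ' hθ.2
  have h5 := weightW2_pos_of_mem hθ' hθ.1
  positivity

/-- On the open range the slot weight sum vanishes iff there is no slot-crossing walk. [cite: GlazmanManolescu2019, §1, eq. (1)] -/
theorem slotWeightSum_eq_zero_iff {θ : ℝ} (hθ : θ ∈ Set.Ioo (π / 3) (2 * π / 3)) (Dl : List Face) (w : Face)
    (σ : Side) : slotWeightSum θ Dl w σ = 0 ↔
      IsEmpty (YBWalk (dom (eraseFace Dl w)) (w.side (lat σ)) (w.side (lat σ).opp)) := by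
  unfold slotWeightSum
  constructor
  · intro h
    by_contra hne
    rw [not_isEmpty_iff] at hne
    obtain ⟨δ⟩ := hne
    have hle : realWeightL θ δ.mids ≤ ∑ δ' : YBWalk (dom (eraseFace Dl w)) (w.side (lat σ)) (w.side (lat σ).opp),
        realWeightL θ δ'.mids :=
      Finset.single_le_sum (fun δ' _ => (realWeightL_pos hθ δ'.mids).le) (Finset.mem_univ δ)
    have hpos := realWeightL_pos hθ δ.mids
    linarith
  · intro h
    exact Finset.sum_eq_zero fun δ _ => (h.false δ).elim

/-- ★★★★ **On the open printed range, the Yang–Baxter vertex identity at the root plaquette of an isthmus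
hole root holds IFF no self-avoiding plaquette walk of `D ∖ {w}` joins the two sides of the slot**
(`θ ∈ (π/3, 2π/3)`, every finite face list, every isthmus hole root; at a genuine hole such walks exist —
they go around the hole — so the identity FAILS there; at a pinch there are none and it holds).
[cite: DuminilCopinSmirnov2012, proof of Lemma 1 («we used the fact that a is on the boundary and Ω is simply connected»)] [cite: GlazmanManolescu2019, Lemma 2.1] -/
theorem vertexFunctional_printed_isthmus_root_eq_zero_iff_isEmpty {θ : ℝ} (hθ : θ ∈ Set.Ioo (π / 3) (2 * π / 3))
    (Dl : List Face) (w : Face) (σ : Side) (hw : w ∈ Dl) (hh : nbr w σ ∉ dom Dl)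
    (hO : OuterRoot (dom Dl) (w.side σ.opp)) :
    vertexFunctional (printedWeights θ) tFiveEighths (ybCoeff θ) Dl (w.side σ) w = 0 ↔
      IsEmpty (YBWalk (dom (eraseFace Dl w)) (w.side (lat σ)) (w.side (lat σ).opp)) := by
  rw [vertexFunctional_printed_isthmus_root_eq_zero_iff_weightSum (Set.Ioo_subset_Icc_self hθ) Dl w σ hw hh hO,
    slotWeightSum_eq_zero_iff hθ]

/-- ★★★★ **Equivalently: the identity FAILS at the root plaquette iff SOME walk of `D ∖ {w}` crosses the slot.**
[cite: DuminilCopinSmirnov2012, proof of Lemma 1] [cite: GlazmanManolescu2019, Lemma 2.1] -/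
theorem vertexFunctional_printed_isthmus_root_ne_zero_iff_nonempty {θ : ℝ} (hθ : θ ∈ Set.Ioo (π / 3) (2 * π / 3))
    (Dl : List Face) (w : Face) (σ : Side) (hw : w ∈ Dl) (hh : nbr w σ ∉ dom Dl)
    (hO : OuterRoot (dom Dl) (w.side σ.opp)) :
    vertexFunctional (printedWeights θ) tFiveEighths (ybCoeff θ) Dl (w.side σ) w ≠ 0 ↔
      Nonempty (YBWalk (dom (eraseFace Dl w)) (w.side (lat σ)) (w.side (lat σ).opp)) := by
  rw [Ne, vertexFunctional_printed_isthmus_root_eq_zero_iff_isEmpty hθ Dl w σ hw hh hO, not_isEmpty_iff]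

end StrictPositivity

end Literature.Barriers.CriticalPhenomena.PlaquetteWalk

/-! ## Part 3b — the hexagonal point `θ = π/3` and the pinch corollary

At `θ = π/3` (`u₁ = x_c`, `u₂ = v = w₁ = x_c²`, `w₂ = 0`, `x_c = 1/√(2+√2)`) the modulus law reads
`‖VF_D(w.side σ, w)‖ = (2 − √2)·‖X‖ = (2 − √2)·B_{π/3}(D, w, σ)` (`2v(π/3) = 2x_c² = 2 − √2`). And on the whole
printed range: if BOTH `w.side σ` and `w.side σ.opp` are outer roots (a pinch, not a hole) the slot
observable vanishes (C-B2 at `w.side σ` makes the defect zero). (The explicit ℚ(ζ₃₂) values of the eight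
defect coefficients at `π/3` — units times `x_c²` — are in the lane's HOME numerics; they follow from
`defectCoeff_printed_values` with `v = x_c²`, `t = y⁵`, `r(π/3) = −y⁹`, `y = e^{−iπ/16}`.)
-/

namespace Literature.Barriers.CriticalPhenomena.PlaquetteWalk

open Literature.Probability.RandomPlanarGeometry.SAW.YangBaxter
open Literature.Probability.RandomPlanarGeometry.SAW.YangBaxter.MidEdge
open Literature.Probability.RandomPlanarGeometry.SAW

section HexPoint

/-- `2x_c² = 2 − √2`. [cite: DuminilCopinSmirnov2012, §1 (x_c = 1/√(2+√2))] -/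
private theorem two_mul_xc_sq₃ : 2 * hexCriticalFugacity ^ 2 = 2 - Real.sqrt 2 := by
  rw [YangBaxter.hexCriticalFugacity_sq]
  have hs : Real.sqrt 2 * Real.sqrt 2 = 2 := Real.mul_self_sqrt (by norm_num)
  have hpos : (0 : ℝ) < 2 + Real.sqrt 2 := by positivity
  field_simp
  linear_combination hs

/-- ★★★ **The modulus law at the hexagonal point**: for every finite face list and every isthmus hole root,
`‖VF_D(w.side σ, w)‖ = (2 − √2)·‖G_{D∖w}(w.side ℓ → w.side ℓ.opp)‖` at `θ = π/3`.
[cite: GlazmanManolescu2019, §1, Fig. 2 (the weights at θ = π/3); Lemma 2.1] [cite: DuminilCopinSmirnov2012, §1, proof of Lemma 1] -/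
theorem norm_vertexFunctional_hex_isthmus_root (Dl : List Face) (w : Face) (σ : Side) (hw : w ∈ Dl)
    (hh : nbr w σ ∉ dom Dl) (hO : OuterRoot (dom Dl) (w.side σ.opp)) :
    ‖vertexFunctional (printedWeights (π / 3)) tFiveEighths (ybCoeff (π / 3)) Dl (w.side σ) w‖ =
      (2 - Real.sqrt 2) *
        ‖gmObservable (printedWeights (π / 3)) tFiveEighths (eraseFace Dl w) (w.side (lat σ)) (w.side (lat σ).opp)‖ := by
  have hx : 0 < hexCriticalFugacity := hexCriticalFugacity_pos_lt_one.1
  rw [norm_vertexFunctional_printed_isthmus_root pi_div_three_mem_Icc Dl w σ hw hh hO, weightV_pi_div_three,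
    abs_of_pos (by positivity), two_mul_xc_sq₃]

/-- ★★★ **The defect at the hexagonal point in final form**: `‖VF_D(w.side σ, w)‖ = (2 − √2)·B_{π/3}(D, w, σ)`.
[cite: GlazmanManolescu2019, §1, Fig. 2; Lemma 2.1] [cite: DuminilCopinSmirnov2012, §1, proof of Lemma 1] -/
theorem norm_vertexFunctional_hex_isthmus_root_eq (Dl : List Face) (w : Face) (σ : Side) (hw : w ∈ Dl)
    (hh : nbr w σ ∉ dom Dl) (hO : OuterRoot (dom Dl) (w.side σ.opp)) :
    ‖vertexFunctional (printedWeights (π / 3)) tFiveEighths (ybCoeff (π / 3)) Dl (w.side σ) w‖ =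
      (2 - Real.sqrt 2) * slotWeightSum (π / 3) Dl w σ := by
  rw [norm_vertexFunctional_printed_isthmus_root_eq pi_div_three_mem_Icc Dl w σ hw hh hO, weightV_pi_div_three,
    two_mul_xc_sq₃]

/-- **The pinch corollary** (all `θ ∈ [π/3, 2π/3]`): if the plaquette across `σ` is missing and BOTH `w.side σ`
and `w.side σ.opp` are outer roots of `D`, the slot observable of `D ∖ {w}` between the lateral sides of `w`
vanishes — C-B2 at the root `w.side σ` makes the defect zero. (Combinatorially: an exterior king-chain through
the two missing plaquettes separates the lateral plaquettes.) [cite: GlazmanManolescu2019, Lemma 2.1] [cite: DuminilCopinSmirnov2012, Lemma 1] -/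
theorem gmObservable_slot_eq_zero_of_outerRoot_both {θ : ℝ} (hθ : θ ∈ Set.Icc (π / 3) (2 * π / 3))
    (Dl : List Face) (w : Face) (σ : Side) (hw : w ∈ Dl) (hh : nbr w σ ∉ dom Dl)
    (hO : OuterRoot (dom Dl) (w.side σ.opp)) (hO' : OuterRoot (dom Dl) (w.side σ)) :
    gmObservable (printedWeights θ) tFiveEighths (eraseFace Dl w) (w.side (lat σ)) (w.side (lat σ).opp) = 0 :=
  (vertexFunctional_printed_isthmus_root_eq_zero_iff_slot hθ Dl w σ hw hh hO).1
    (vertexFunctional_printed_eq_zero hθ Dl (w.side σ) hO' w hw)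

/-- **No walk crosses a pinch** (`θ`-free combinatorial form, read off at `θ = π/2`): under the same hypotheses
there is no walk of `D ∖ {w}` between the two lateral sides of `w`. [cite: GlazmanManolescu2019, Lemma 2.1] -/
theorem isEmpty_slot_of_outerRoot_both (Dl : List Face) (w : Face) (σ : Side) (hw : w ∈ Dl)
    (hh : nbr w σ ∉ dom Dl) (hO : OuterRoot (dom Dl) (w.side σ.opp)) (hO' : OuterRoot (dom Dl) (w.side σ)) :
    IsEmpty (YBWalk (dom (eraseFace Dl w)) (w.side (lat σ)) (w.side (lat σ).opp)) := by
  have hθ : (π / 2 : ℝ) ∈ Set.Ioo (π / 3) (2 * π / 3) := ⟨by linarith [Real.pi_pos], by linarith [Real.pi_pos]⟩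
  exact (vertexFunctional_printed_isthmus_root_eq_zero_iff_isEmpty hθ Dl w σ hw hh hO).1
    (vertexFunctional_printed_eq_zero (Set.Ioo_subset_Icc_self hθ) Dl (w.side σ) hO' w hw)

end HexPoint

end Literature.Barriers.CriticalPhenomena.PlaquetteWalk

/-! ## Part 3i — the defect is NONZERO at every fully-ringed single-plaquette hole

If the seven plaquettes around the missing plaquette `N = nbr w σ` other than `w` itself all lie in `D`
(the «ring» of `N`: `w`'s two lateral neighbours and the five plaquettes beyond them around `N`), the explicit
ring walk of `D ∖ {w}` from `w.side ℓ` around `N` to `w.side ℓ.opp` exists (`ringWalk`), so `B > 0` and, for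
`θ ∈ (π/3, 2π/3)`, ★★★★ `vertexFunctional_printed_ring_hole_ne_zero`: **the Yang–Baxter vertex identity FAILS
at the root plaquette** — an unconditional negative theorem for an infinite family of holed domains (every
finite face list containing the ring, with `N ∉ D` and the plaquette across `w` from `N` on the outer boundary;
e.g. the lane's `ring8`, `holed11`, `holed5×4`). The general «genuine hole ⇒ a slot-crossing walk exists» is the
digital-topology item of `DESIGN-next.md`.
-/

namespace Literature.Barriers.CriticalPhenomena.PlaquetteWalk

open Literature.Probability.RandomPlanarGeometry.SAW.YangBaxter
open Literature.Probability.RandomPlanarGeometry.SAW.YangBaxter.MidEdge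
open Literature.Probability.RandomPlanarGeometry.SAW

section Ring

variable {Dl : List Face} {w : Face} {σ : Side}

/-- The shared side: the `s.opp` side of the plaquette across `s` is the `s` side of `f`. [folklore] -/
private theorem side_nbr_opp₃ (f : Face) (s : Side) : (nbr f s).side s.opp = f.side s := by
  obtain ⟨x, y⟩ := f
  cases s <;> simp [nbr, Face.side, Side.opp]

/-- Moving across a side changes the plaquette. [folklore] -/
private theorem nbr_ne_self₃ (f : Face) (s : Side) : nbr f s ≠ f := by
  obtain ⟨x, y⟩ := f
  cases s <;> simp [nbr]

/-- Entry sides of the seven arcs of the ring walk (hole side `σ`, `ℓ = lat σ`):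
`ℓ.opp, σ.opp, σ.opp, ℓ, ℓ, σ, σ`. [folklore] -/
def ringEntry (σ : Side) : ℕ → Side
  | 0 => (lat σ).opp
  | 1 => σ.opp
  | 2 => σ.opp
  | 3 => lat σ
  | 4 => lat σ
  | 5 => σ
  | _ => σ

/-- Exit sides of the seven arcs of the ring walk: `σ, σ, ℓ.opp, ℓ.opp, σ.opp, σ.opp, ℓ`. [folklore] -/
def ringExit (σ : Side) : ℕ → Side
  | 0 => σ
  | 1 => σ
  | 2 => (lat σ).opp
  | 3 => (lat σ).opp
  | 4 => σ.opp
  | 5 => σ.opp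
  | _ => lat σ

/-- The seven plaquettes of the ring walk: the lateral neighbour `nbr w ℓ`, then across each exit side
(they are the king-neighbours of `nbr w σ` other than `w`). [folklore] -/
def ringFace (w : Face) (σ : Side) : ℕ → Face
  | 0 => nbr w (lat σ)
  | i + 1 => nbr (ringFace w σ i) (ringExit σ i)

/-- The eight mid-edges of the ring walk. [folklore] -/
def ringMid (w : Face) (σ : Side) (i : ℕ) : MidEdge :=
  if i ≤ 6 then (ringFace w σ i).side (ringEntry σ i) else (ringFace w σ 6).side (ringExit σ 6)

/-- The next arc enters through the side opposite to the previous exit. [folklore] -/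
private theorem ringEntry_succ₃ (σ : Side) {i : ℕ} (hi : i ≤ 5) : ringEntry σ (i + 1) = (ringExit σ i).opp := by
  interval_cases i <;> simp [ringEntry, ringExit, Side.opp_opp]

/-- An arc enters and leaves through different sides. [folklore] -/
private theorem ringEntry_ne_exit₃ (σ : Side) {i : ℕ} (hi : i ≤ 6) : ringEntry σ i ≠ ringExit σ i := by
  interval_cases i <;> cases σ <;> decide

/-- Gluing: the next mid-edge is the exit side of the current plaquette. [folklore] -/
private theorem ringMid_succ₃ (w : Face) (σ : Side) {i : ℕ} (hi : i ≤ 6) :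
    ringMid w σ (i + 1) = (ringFace w σ i).side (ringExit σ i) := by
  unfold ringMid
  rcases Nat.lt_or_ge i 6 with h | h
  · rw [if_pos (by omega), show ringFace w σ (i + 1) = nbr (ringFace w σ i) (ringExit σ i) from rfl,
      ringEntry_succ₃ σ (by omega), side_nbr_opp₃]
  · have : i = 6 := by omega
    subst this
    rw [if_neg (by omega)]

/-- The current mid-edge is the entry side of the current plaquette. [folklore] -/
private theorem ringMid_eq₃ (w : Face) (σ : Side) {i : ℕ} (hi : i ≤ 6) :
    ringMid w σ i = (ringFace w σ i).side (ringEntry σ i) := by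
  unfold ringMid; rw [if_pos hi]

/-- The ring walk starts at `w.side ℓ`. [folklore] -/
private theorem ringMid_zero₃ (w : Face) (σ : Side) : ringMid w σ 0 = w.side (lat σ) := by
  rw [ringMid_eq₃ w σ (by omega)]
  exact side_nbr_opp₃ w (lat σ)

/-- The last ring plaquette is the other lateral neighbour of `w`. [folklore] -/
private theorem ringFace_six₃ (w : Face) (σ : Side) : ringFace w σ 6 = nbr w (lat σ).opp := by
  obtain ⟨x, y⟩ := w
  cases σ <;> simp [ringFace, ringExit, nbr, lat, Side.opp]

/-- The ring walk ends at `w.side ℓ.opp`. [folklore] -/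
private theorem ringMid_seven₃ (w : Face) (σ : Side) : ringMid w σ 7 = w.side (lat σ).opp := by
  rw [ringMid_succ₃ w σ (by omega), ringFace_six₃, show ringExit σ 6 = lat σ from rfl]
  have h := side_nbr_opp₃ w (lat σ).opp
  rwa [Side.opp_opp] at h

/-- Each arc of the ring walk lies in its plaquette. [folklore] -/
private theorem ringArc₃ (w : Face) (σ : Side) {i : ℕ} (hi : i < 7) :
    arcFace (ringMid w σ i, ringMid w σ (i + 1)) = some (ringFace w σ i) := by
  rw [ringMid_eq₃ w σ (by omega), ringMid_succ₃ w σ (by omega)]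
  exact arcFace_side_side _ _ _ (ringEntry_ne_exit₃ σ (by omega))

/-- Codes `(vertical?, dx, dy)` of the eight ring mid-edges relative to `w = (x, y)`. [folklore] -/
private def ringMidCode (σ : Side) (i : ℕ) : Bool × ℤ × ℤ :=
  match σ, i with
  | .W, 0 => (false, 0, 0)
  | .W, 1 => (true, 0, -1)
  | .W, 2 => (true, -1, -1)
  | .W, 3 => (false, -2, 0)
  | .W, 4 => (false, -2, 1)
  | .W, 5 => (true, -1, 1)
  | .W, 6 => (true, 0, 1)
  | .W, 7 => (false, 0, 1)
  | .E, 0 => (false, 0, 0)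
  | .E, 1 => (true, 1, -1)
  | .E, 2 => (true, 2, -1)
  | .E, 3 => (false, 2, 0)
  | .E, 4 => (false, 2, 1)
  | .E, 5 => (true, 2, 1)
  | .E, 6 => (true, 1, 1)
  | .E, 7 => (false, 0, 1)
  | .S, 0 => (true, 0, 0)
  | .S, 1 => (false, -1, 0)
  | .S, 2 => (false, -1, -1)
  | .S, 3 => (true, 0, -2)
  | .S, 4 => (true, 1, -2)
  | .S, 5 => (false, 1, -1)
  | .S, 6 => (false, 1, 0)
  | .S, 7 => (true, 1, 0)
  | .N, 0 => (true, 0, 0)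
  | .N, 1 => (false, -1, 1)
  | .N, 2 => (false, -1, 2)
  | .N, 3 => (true, 0, 2)
  | .N, 4 => (true, 1, 2)
  | .N, 5 => (false, 1, 2)
  | .N, 6 => (false, 1, 1)
  | .N, 7 => (true, 1, 0)
  | _, _ => (true, 0, 0)

/-- Offsets of the seven ring plaquettes relative to `w`. [folklore] -/
private def ringFaceCode (σ : Side) (i : ℕ) : ℤ × ℤ :=
  match σ, i with
  | .W, 0 => (0, -1)
  | .W, 1 => (-1, -1)
  | .W, 2 => (-2, -1)
  | .W, 3 => (-2, 0)
  | .W, 4 => (-2, 1)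
  | .W, 5 => (-1, 1)
  | .W, 6 => (0, 1)
  | .E, 0 => (0, -1)
  | .E, 1 => (1, -1)
  | .E, 2 => (2, -1)
  | .E, 3 => (2, 0)
  | .E, 4 => (2, 1)
  | .E, 5 => (1, 1)
  | .E, 6 => (0, 1)
  | .S, 0 => (-1, 0)
  | .S, 1 => (-1, -1)
  | .S, 2 => (-1, -2)
  | .S, 3 => (0, -2)
  | .S, 4 => (1, -2)
  | .S, 5 => (1, -1)
  | .S, 6 => (1, 0)
  | .N, 0 => (-1, 0)
  | .N, 1 => (-1, 1)
  | .N, 2 => (-1, 2)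
  | .N, 3 => (0, 2)
  | .N, 4 => (1, 2)
  | .N, 5 => (1, 1)
  | .N, 6 => (1, 0)
  | _, _ => (0, 0)

/-- A mid-edge from a code. [folklore] -/
private def codeMid (x y : ℤ) (c : Bool × ℤ × ℤ) : MidEdge :=
  if c.1 then .vert (x + c.2.1) (y + c.2.2) else .slant (x + c.2.1) (y + c.2.2)

/-- `codeMid` is injective in the code. [folklore] -/
private theorem codeMid_inj₃ (x y : ℤ) {c c' : Bool × ℤ × ℤ} (h : codeMid x y c = codeMid x y c') : c = c' := by
  obtain ⟨b, dx, dy⟩ := c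
  obtain ⟨b', dx', dy'⟩ := c'
  cases b <;> cases b' <;> simp [codeMid] at h ⊢ <;> omega

/-- The ring mid-edges in coordinates. [folklore] -/
private theorem ringMid_eq_code₃ (x y : ℤ) (σ : Side) {i : ℕ} (hi : i ≤ 7) :
    ringMid (x, y) σ i = codeMid x y (ringMidCode σ i) := by
  interval_cases i <;> cases σ <;>
    simp [ringMid, ringFace, ringEntry, ringExit, nbr, lat, Side.opp, Face.side, ringMidCode, codeMid] <;> omega

/-- The ring plaquettes in coordinates (the king-neighbours of the hole plaquette other than `w`). [folklore] -/
private theorem ringFace_eq_code₃ (x y : ℤ) (σ : Side) {i : ℕ} (hi : i ≤ 6) :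
    ringFace (x, y) σ i = (x + (ringFaceCode σ i).1, y + (ringFaceCode σ i).2) := by
  interval_cases i <;> cases σ <;> simp [ringFace, ringExit, nbr, lat, Side.opp, ringFaceCode] <;> omega

/-- The mid-edge codes are pairwise distinct. [folklore] -/
private theorem ringMidCode_inj₃ : ∀ (σ : Side) (i j : Fin 8), ringMidCode σ i = ringMidCode σ j → i = j := by
  decide

/-- The plaquette offsets are pairwise distinct and nonzero. [folklore] -/
private theorem ringFaceCode_inj₃ : ∀ (σ : Side) (i j : Fin 7), ringFaceCode σ i = ringFaceCode σ j → i = j := by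
  decide

/-- No ring plaquette offset is zero. [folklore] -/
private theorem ringFaceCode_ne_zero₃ : ∀ (σ : Side) (i : Fin 7), ringFaceCode σ i ≠ (0, 0) := by
  decide

/-- The eight ring mid-edges are pairwise distinct. [folklore] -/
private theorem ringMid_inj₃ (w : Face) (σ : Side) :
    ∀ i j, i ≤ 7 → j ≤ 7 → ringMid w σ i = ringMid w σ j → i = j := by
  obtain ⟨x, y⟩ := w
  intro i j hi hj h
  rw [ringMid_eq_code₃ x y σ hi, ringMid_eq_code₃ x y σ hj] at h
  have := ringMidCode_inj₃ σ ⟨i, by omega⟩ ⟨j, by omega⟩ (codeMid_inj₃ x y h)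
  simpa using this

/-- No ring plaquette is `w`. [folklore] -/
private theorem ringFace_ne_self₃ (w : Face) (σ : Side) {i : ℕ} (hi : i ≤ 6) : ringFace w σ i ≠ w := by
  obtain ⟨x, y⟩ := w
  rw [ringFace_eq_code₃ x y σ hi]
  intro h
  have h1 := (Prod.mk.inj h).1
  have h2 := (Prod.mk.inj h).2
  exact ringFaceCode_ne_zero₃ σ ⟨i, by omega⟩ (Prod.ext (by simpa using h1) (by simpa using h2))

/-- The ring plaquettes are pairwise distinct. [folklore] -/
private theorem ringFace_inj₃ (w : Face) (σ : Side) {i j : ℕ} (hi : i ≤ 6) (hj : j ≤ 6)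
    (h : ringFace w σ i = ringFace w σ j) : i = j := by
  obtain ⟨x, y⟩ := w
  rw [ringFace_eq_code₃ x y σ hi, ringFace_eq_code₃ x y σ hj] at h
  have h1 := (Prod.mk.inj h).1
  have h2 := (Prod.mk.inj h).2
  have := ringFaceCode_inj₃ σ ⟨i, by omega⟩ ⟨j, by omega⟩ (Prod.ext (by simpa using h1) (by simpa using h2))
  simpa using this

/-- The ring walk has no two crossing straight arcs in one plaquette: each ring plaquette carries exactly one
arc. [folklore] -/
private theorem ring_nc₃ (w : Face) (σ : Side) : ∀ i j, i < 7 → j < 7 → ∀ f : Face,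
    IsWE f (ringMid w σ i, ringMid w σ (i + 1)) → ¬IsSN f (ringMid w σ j, ringMid w σ (j + 1)) := by
  intro i j hi hj f hWE hSN
  have hfi : f = ringFace w σ i := by
    have h1 : arcFace (ringMid w σ i, ringMid w σ (i + 1)) = some f := by
      rcases hWE with h | h <;> rw [h] <;> exact arcFace_side_side f _ _ (by decide)
    rw [ringArc₃ w σ hi] at h1
    exact (Option.some_injective _ h1).symm
  have hfj : f = ringFace w σ j := by
    have h1 : arcFace (ringMid w σ j, ringMid w σ (j + 1)) = some f := by
      rcases hSN with h | h <;> rw [h] <;> exact arcFace_side_side f _ _ (by decide)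
    rw [ringArc₃ w σ hj] at h1
    exact (Option.some_injective _ h1).symm
  have hij : i = j := ringFace_inj₃ w σ (by omega) (by omega) (hfi.symm.trans hfj)
  subst hij
  rw [ringMid_eq₃ w σ (by omega), ringMid_succ₃ w σ (by omega), ← hfi] at hWE hSN
  rcases hWE with h | h <;> rcases hSN with h' | h' <;>
    exact absurd ((Face.side_injective f (Prod.mk.inj h).1).symm.trans (Face.side_injective f (Prod.mk.inj h').1))
      (by decide)

/-- ★ **The ring walk**: if the seven plaquettes around the missing plaquette `nbr w σ` other than `w` all lie
in `Dl`, the explicit self-avoiding plaquette walk of `D ∖ {w}` from `w.side ℓ` around the hole to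
`w.side ℓ.opp` (`ℓ = lat σ`; arcs: corner in `nbr w ℓ`, straight, corner, straight, corner, straight, corner).
[cite: GlazmanManolescu2019, §1 (the walks of the model)] -/
def ringWalk (hring : ∀ i ≤ 6, ringFace w σ i ∈ Dl) :
    YBWalk (dom (eraseFace Dl w)) (w.side (lat σ)) (w.side (lat σ).opp) :=
  (YBWalk.ofFn (D := dom (eraseFace Dl w)) 7 (ringMid w σ) (ringMid_inj₃ w σ)
    (fun i hi => ⟨ringFace w σ i, mem_eraseFace.2 ⟨hring i (by omega), ringFace_ne_self₃ w σ (by omega)⟩,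
      ringArc₃ w σ hi⟩)
    (fun i hi h => by
      rw [ringArc₃ w σ (by omega), ringArc₃ w σ (by omega)] at h
      exact nbr_ne_self₃ (ringFace w σ i) (ringExit σ i) (Option.some_injective _ h).symm)
    (ring_nc₃ w σ)).cast (ringMid_zero₃ w σ) (ringMid_seven₃ w σ)

/-- The ring hypothesis in coordinates, for the record: for `σ = N` and `w = (x, y)` the seven plaquettes are
`(x−1,y), (x−1,y+1), (x−1,y+2), (x,y+2), (x+1,y+2), (x+1,y+1), (x+1,y)` — the king-neighbours of the hole
plaquette `(x, y+1)` other than `w` (and rotated accordingly for the other `σ`). [folklore] -/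
private theorem ringFace_N₃ (x y : ℤ) :
    (List.range 7).map (ringFace (x, y) .N) =
      [(x - 1, y), (x - 1, y + 1), (x - 1, y + 2), (x, y + 2), (x + 1, y + 2), (x + 1, y + 1), (x + 1, y)] := by
  simp [List.range_succ, ringFace, ringExit, nbr, lat, Side.opp]
  omega

/-- ★★★★ **The Yang–Baxter vertex identity FAILS at the root plaquette of every fully-ringed single-plaquette
hole**: for every `θ ∈ (π/3, 2π/3)`, every finite face list `Dl`, every `w ∈ Dl` whose neighbour across `σ` is
missing while its seven other king-neighbours lie in `Dl`, and whose side opposite to `σ` is an outer root: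
`VF_D(w.side σ, w) ≠ 0` (indeed `‖VF‖ = 2v(θ)·B` with `B ≥ w_θ(ring walk) > 0`).
[cite: DuminilCopinSmirnov2012, proof of Lemma 1 («we used the fact that a is on the boundary and Ω is simply connected»)] [cite: GlazmanManolescu2019, Lemma 2.1] -/
theorem vertexFunctional_printed_ring_hole_ne_zero {θ : ℝ} (hθ : θ ∈ Set.Ioo (π / 3) (2 * π / 3))
    (Dl : List Face) (w : Face) (σ : Side) (hw : w ∈ Dl) (hh : nbr w σ ∉ dom Dl)
    (hO : OuterRoot (dom Dl) (w.side σ.opp)) (hring : ∀ i ≤ 6, ringFace w σ i ∈ Dl) :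
    vertexFunctional (printedWeights θ) tFiveEighths (ybCoeff θ) Dl (w.side σ) w ≠ 0 :=
  (vertexFunctional_printed_isthmus_root_ne_zero_iff_nonempty hθ Dl w σ hw hh hO).2 ⟨ringWalk hring⟩

/-- The lane's `ring8` instance (the 3 × 3 block minus its centre; hole root = the N side of the missing centre
= the S side of `w = (1, 2)`; `w.side N` on the outer boundary): the identity FAILS at `w` for every
`θ ∈ (π/3, 2π/3)` — the tree's F9 datum at `θ = π/3` extended to the open range by the general theorem
(the outer-root hypothesis is supplied by the caller; for `ring8` it is an explicit one-step exterior chain).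
[cite: GlazmanManolescu2019, Lemma 2.1] -/
example {θ : ℝ} (hθ : θ ∈ Set.Ioo (π / 3) (2 * π / 3))
    (hO : OuterRoot (dom [((0 : ℤ), (0 : ℤ)), (1, 0), (2, 0), (0, 1), (2, 1), (0, 2), (1, 2), (2, 2)])
      (Face.side (1, 2) (Side.opp .S))) :
    vertexFunctional (printedWeights θ) tFiveEighths (ybCoeff θ)
      [((0 : ℤ), (0 : ℤ)), (1, 0), (2, 0), (0, 1), (2, 1), (0, 2), (1, 2), (2, 2)] (Face.side (1, 2) .S) (1, 2) ≠ 0 :=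
  vertexFunctional_printed_ring_hole_ne_zero hθ _ (1, 2) .S (by decide) (by simp [dom, nbr]) hO
    (by intro i hi; interval_cases i <;> decide)

end Ring

end Literature.Barriers.CriticalPhenomena.PlaquetteWalk
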